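import Mathlib
import HarnessLib
import HarnessLib.Audit
import Summits.QuantumFields.Statement
import Literature.MathematicalPhysics.QuantumFieldTheory.QCDCalibratedSpecies
import Summits.QuantumFields.QCD.Theorems.CentreStabilisedCircleOffsetToFull
import HarnessLib.Audit.Status.Attr

/-!
Route: CounterexampleMustBeHot

DORMANT since 2026-08-30T01:42:15Z (rlead D-0179: BLOCKER=stmt-QuantumFields-18758 ≡ L (CostumeSandwich.costume_iff / BlockerNode rc 0); reduces-to L ∧ (L→QCD); ∀-laws 10191/18760/10193/18759 kept as FRONTIER record items; hold on 18758) — unstaffed, not closed; items shared with open routes are served there. `ledger route dormant <id> --off` reactivates.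

# Route CounterexampleMustBeHot — a counterexample must be hot — one cold thermal certificate F(T₁)
< 1, transported to T = 0 by the sign of the lattice interaction measure, closes the QCD gap

It suffices to show X = Θ⁺-TRANSPORT ∧ COLD CERTIFICATE ∧ COLD-INFRARED CLOSURE (card
QuantumFields/QCD/counterexample-must-be-hot),
plus the UV/OS complement ChiralContinuumComplement (CHIRAL lattice half ⇒ conjunct). REPAIR
2026-08-16 (statement re-type p117723:
`QCDOf N_f := ∃ reg, HasMassScaling ∧ IsChiralAtZero ∧ ∀ m > 0, body`): the new conjunct
`reg.IsChiralAtZero` (for every ε > 0 some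
positive mass tuple has no uniform lattice gap ε — the gap closes as m → 0⁺, pinning the additive
offset of m_crit to the chiral point) is
NOT proved by this line; it is carried as a HYPOTHESIS inside the ∃ of the certificate
(ChiralColdCertificate) and handed verbatim through
ChiralContinuumComplement, and the threshold machinery (M₀, OffsetToFull's shift m_crit ↦ m_crit +
a_k M₀/Z_m — exactly what chirality
forbids, Negative.ChiralityObstruction) has left the chain: the certificate is now asked at EVERY
positive mass tuple. Objects (typed inline over Mathlib on the asymmetric lattice ℤ_{N_t} × ℤ_{N_s}³
— sites `ZMod Nt × (Fin 3 → ZMod Ns)`, SU(3) links,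
product Haar measure: the Borgs–Seiler finite-temperature lattice re-typed so that the route imports
nothing beyond the Statement): the honest THERMAL partition function Z_k(N_t, N_s) of Wilson SU(3) +
N_f antiperiodic
Wilson quarks at the scheme's bare (β_k, m_f(k)); the free energy per site f_k(N_t, N_s) =
−log‖Z‖/(N_t N_s³); its spatial
thermodynamic limit φ_k(N_t) and vacuum energy density e₀(k) = lim_{N_t} φ_k(N_t) (carried as
functions with `Tendsto` hypotheses,
`Lim`); the thermal degree-of-freedom count F_k(N_t) = (90/π²) N_t⁴ (e₀(k) − φ_k(N_t)) (= p/T⁴ in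
Stefan–Boltzmann units, one free
boson = 1) and its finite-volume twin F^fin_k(N_t, N_s) = (90/π²) N_t⁴ (e₀(k) − f_k(N_t, N_s)). With
N₁(k) = ⌈1/(a_k T₁)⌉:
COLD CERTIFICATE (`ChiralColdCertificate`, ∃-form like QCDOf): one mass-independent regularisation,
CHIRAL AT ZERO, such that for every
positive mass tuple limits exist and ∃ η < 1, T₁ > 0 with F^fin_k(N₁(k), N_s) ≤ η for all N_s ≥
N₁(k), eventually in k (cold at ONE temperature,
at aspect ratios ≥ 1 — which also certifies a non-degenerate vacuum, since n ≥ 2 degenerate vacua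
give F^fin ≥ (90/π²) log 2 = 6.3);
Θ⁺-TRANSPORT (`ThetaPlusTransport`, ∀ trajectories): that certificate implies F_k(N') ≤ η for ALL N'
≥ N₁(k) eventually in k
(coldness propagates downward in temperature: the lattice interaction measure ε − 3p = T⁵∂_T(p/T⁴)
is ≥ 0 in the cold regime);
COLD-INFRARED CLOSURE (`ColdInfraredGap`, ∀ trajectories): cold at aspect ratio ≥ 1 at T₁ and cold
at every T ≤ T₁ ⇒ a volume-uniform
full-spectrum lattice gap `HasLatticeMassGap Δ` for some Δ > 0 (every gapless or light infrared is
quantised-hot: F ≥ 1 per boson,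
7/4 per Dirac fermion, c_therm > 0 for a CFT). Then ChiralContinuumComplement gives QCD := QCDOf 2 ∧
QCDOf 3 (the same chiral reg serves the conjunct).
Lean: `ThetaPlusTransport ∧ ChiralColdCertificate ∧ ColdInfraredGap ∧ ChiralContinuumComplement`
(the four crux decls below; `closes : ThetaPlusTransport → ChiralColdCertificate → ColdInfraredGap →
ChiralContinuumComplement → QCD` is the deciding theorem, pure logic, certified native at rev 4)

## Assembly
Pure logic (theorem `closes`, glue.lean, sorry-free, axioms propext/Classical.choice/Quot.sound):
fix N_f ∈ {2, 3};
ChiralColdCertificate gives reg with HasMassScaling, IsChiralAtZero, HasAsymptoticScaling and, for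
each m > 0, the branch clause, limit
functions φ, e₀ with `Lim`, and η, T₁ with the finite-volume certificate; ThetaPlusTransport
(instantiated at that reg, m, φ, e₀, η, T₁)
turns the certificate into coldness at every N' ≥ N₁(k); ColdInfraredGap turns certificate +
coldness-below into ∃ Δ > 0,
HasLatticeMassGap Δ; together this is the CHIRAL lattice half (same reg, chirality carried along),
which ChiralContinuumComplement turns
into QCD := QCDOf 2 ∧ QCDOf 3. StrongCouplingAnchor is not a hypothesis of `closes`; the Assembly
item is literally the type of `closes`.

Rationale: WHY THIS LINE. INVERSION (card counterexample-must-be-hot, graded new-combination): a counterexample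
to QCDOf at positive masses is a gapless or
arbitrarily-light continuum limit of lattice SU(3) + Wilson quarks, and every classified gapless
infrared is HOT at all low
temperatures — free photons/Goldstones/fermions give F_IR ∈ {n + 7m/4} ≥ 1, an interacting CFT gives
F_IR = c_therm > 0
(Appelquist–Cohen–Schmaltz doi:10.1103/physrevd.60.045003 define exactly this F and count infrared
d.o.f. with it; 2D closure is a
theorem: FriedanQiuShenker1984 + Cardy1986OperatorContent) — while a gapped theory is COLD, F ≍
(M/T)^{3/2}e^{−M/T}. So the mass gap
becomes ONE-SIDED COLDNESS, certified by ONE free-energy number at ONE sub-deconfinement temperature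
T₁ (the native output of
multiscale expansions: a partition function, not a correlation decay), and transported to T → 0 by a
SIGN: the zero-density lattice
interaction measure (ε − 3p ≥ 0 ⟺ p/T⁴ non-decreasing ⟺ "heating only liberates degrees of
freedom"), non-negative in every solvable
corner (strong coupling, free lattice fields for N_t ≥ 2, two-loop plasma) and at every published
zero-density lattice point
(doi:10.1016/0550-3213(96)00170-8, arXiv:1204.6184, arXiv:1407.6387), conjectured in continuum form
by arXiv:2207.06753. Imported
areas: thermodynamic/transfer-matrix spectral theory (Luscher1977, OsterwalderSeiler1978: Z_AP = Tr
𝒯^{N_t} > 0 for κ < 1/6, F ≥ 0 by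
reflection positivity) and thermal CFT d.o.f. counting; the finite-temperature lattice of
BorgsSeiler1983 is used with L_t → ∞ at FIXED
β_k (downward in T), never at fixed L_t, and no centre order parameter appears, so dynamical quarks
cost nothing. What no prior route
has: the 22 QCD and 17 YangMills route files use RG/UV stability, RP transfer in the quark mass,
small spatial circles with centre
stabilisation, mobility gaps, dualities — none uses temperature as the transport parameter or a
thermodynamic certificate; the pool
card pressure-boltzmann-gap-criterion (YangMills, closed variant) had the dictionary "gap ⟺ cold"
but no transport and no closure.

RANKED CRUXES. #2 ThetaPlusTransport (crux) — (card K1, Θ⁺ restricted to the cold regime) for N_f ∈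
{2,3}, EVERY regularisation reg with leading-log mass scaling and two-loop asymptotic scaling, every
mass tuple m whose bare trajectory stays on the physical branch m_f(k) > −1, all limit functions φ,
e₀ satisfying `Lim`, every η < 1 and T₁ > 0: IF the finite-volume certificate holds (eventually in
k, F^fin_k(N₁(k), N_s) ≤ η for all N_s ≥ N₁(k) = ⌈1/(a_k T₁)⌉) THEN eventually in k, F_k(N') ≤ η for
every N' ≥ N₁(k) — coldness certified at temperature T₁ persists at all lower temperatures. Intended
proof: F^fin(N₁, N_s) → F(N₁) as N_s → ∞, then Θ⁺: N_t ↦ F_k(N_t) is non-increasing on [N₁(k), ∞)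
(four equivalent faces: microcanonical σ(e)/e^{3/4} non-decreasing; the thermal circle orders the
plaquette, ⟨s⟩_{N_t} ≤ ⟨s⟩_∞; Boltzmann-averaged Feynman–Hellmann action deficit ≤ 0; specific-heat
stochastic dominance). The cold premise removes exactly the known non-monotone class (infrared-free
gauge phases are hot, F ≥ 2) and all hot/deconfined points. [difficulty: open-problem] (why it might
fail: No proof principle for ε−3p ≥ 0 beyond strong coupling / free lattice fields (N_t ≥ 2); ACS
show non-monotone F in IR-free phases (hot, excluded here); one cold confined point where p/T⁴ dips
toward lower T (repulsion/resonance effects) refutes it for that (η, T₁).)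
[doi:10.1103/physrevd.60.045003, doi:10.1016/0550-3213(96)00170-8, arXiv:1204.6184, arXiv:1407.6387,
arXiv:2207.06753, doi:10.1016/0550-3213(89)90349-0, Luscher1977]
#3 ChiralColdCertificate (crux) — (card K2, the single non-perturbative number, now carrying the
re-typed conjunct's chirality clause; ∃-form exactly like QCDOf; supersedes ColdCertificate
stmt-QuantumFields-10192, dropped at the repair of 2026-08-16) for N_f = 2 and N_f = 3 there is ONE
mass-independent regularisation reg (HasMassScaling, two-loop HasAsymptoticScaling) which is CHIRAL
AT ZERO — reg.IsChiralAtZero: for every ε > 0 some positive mass tuple has no uniform lattice gap ε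
(Goldstone pions; this pins the flavour-blind additive offset of m_crit to the chiral point, so no
threshold M₀ can be shifted away any more) — such that for EVERY positive mass tuple m: the bare
masses stay on the physical branch; the spatial thermodynamic limits φ_k(N_t) of the thermal free
energy per site and the zero-temperature limits e₀(k) exist (`Lim`); and there are η < 1 and a
temperature T₁ > 0 depending on m (T₁(m) → 0 in the chiral regime: T₁ ≲ m_π/4, m_π² ∝ m) such that
eventually in k, at the single temporal extent N₁(k) = ⌈1/(a_k T₁)⌉ and for EVERY spatial size N_s ≥
N₁(k), (90/π²) N₁⁴ (e₀(k) − f_k(N₁, N_s)) ≤ η: QCD at temperature T₁ is colder than one free boson,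
uniformly in the cutoff and in spatial boxes of aspect ratio ≥ 1 (the aspect-ratio clause certifies
a non-degenerate vacuum: n degenerate vacua contribute ≥ (90/π²) log 2 ≈ 6.3 to F^fin at N_s = N₁).
Working form (in-tree thresholdShift_generic, isChiralAtZero_mcrit_shift_iff,
qcdOf_iff_pinnedThreshold): produce reg₀ and a PINNED threshold P — certificate above P,
gapless-at-every-rate points just above P — and shift m_crit by P. [difficulty: open-problem] (why
it might fail: log‖Z‖ to ABSOLUTE precision η(π²/90)N₁⁻⁴ per site uniformly in k and N_s ≥ N₁ is
beyond Balaban UV stability, and is now needed for ALL m > 0 — T₁(m) → 0, N₁(k) → ∞ as m → 0⁺ —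
together with chirality of the SAME reg (gaplessness of massless N_f = 2, 3 Wilson-lattice QCD,
unproved); aspect-1 degeneracy entropy still breaks it.) [Balaban1988Convergent,
Literature.Barriers.QuantumFields.UVStabilityNonUniqueness, OsterwalderSeiler1978, Luscher1977,
Luscher1986, MontvayMunster1994, SharpeSingleton1998, GellmannOakesRenner1968]
#4 ColdInfraredGap (crux) — (card K3, IR-minimality made a lattice lemma) for N_f ∈ {2,3}, every reg
(mass scaling, asymptotic scaling), every mass tuple on the physical branch, all φ, e₀ with `Lim`,
every η < 1, T₁ > 0: IF the finite-volume certificate at N₁(k) holds (aspect ratios ≥ 1) AND F_k(N')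
≤ η for all N' ≥ N₁(k), both eventually in k, THEN ∃ Δ > 0 with `(reg.scheme m 0
0).HasLatticeMassGap Δ` (all gauge-invariant local observables, all tori ≥ the scheme's, uniformly
in the volume; the thermal trace counts every flavour/baryon sector, so nothing is certified on a
sub-space). Content: (i) quantisation of free/Goldstone/photon infrareds (hypercubic symmetry ⇒ unit
velocity ⇒ F_IR ≥ 1 > η), (ii) THERMAL GAP OF 4D CFT: inf{c_therm : interacting unitary 4D CFT with
stress tensor} > η is what a conformal infrared would need to evade, (iii) no
generalised-free-field-like infrared for a local RP lattice theory, (iv) quantitative single-species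
bound: one boson of mass M has F(M/T) = 0.78, 0.47, 0.26, 0.06 at M/T = 1, 2, 3, 5, so cold-below-T₁
forces every species mass ≥ x(η)T₁ uniformly in k, and transfer-matrix positivity (κ < 1/6) turns
the uniform spectral gap into clustering with pair-wise constants (wrap-around bookkeeping of
`HasLatticeMassGap`); degenerate vacua (Dashen/Aoki-type phases reachable by universally quantified
trajectories with negative physical masses) are excluded by the aspect-ratio-1 clause, light
lattice-artefact states (m ∝ aΛ²) by the infinite-volume clause. [deps: ThetaPlusTransport,
ColdCertificate] [difficulty: open-problem] (why it might fail: Thermal gap of 4D CFT (inf c_therm >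
η) and absence of generalised-free/exotic cold gapless infrareds for RP lattice gauge theories are
open; a cold phase with degeneracy invisible at aspect ratio 1 (topological order) would also pass
the premise — none expected for SU(3)+fundamentals.) [doi:10.1103/physrevd.60.045003,
arXiv:0905.4229, FriedanQiuShenker1984, Cardy1986OperatorContent, arXiv:hep-lat/9804028,
arXiv:hep-lat/0312018, arXiv:1409.2548, Luscher1977, OsterwalderSeiler1978]
#5 ChiralContinuumComplement (crux) — (UV/OS complement RE-TYPED for the chiral conjunct; supersedes
on this route the shared ContinuumComplement stmt-QuantumFields-9643, which stays with
CentreStabilisedCircle; lowest on the chain) THE CHIRAL LATTICE HALF implies the conjunct: if for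
N_f = 2 and 3 one mass-independent regularisation with mass scaling and asymptotic scaling is chiral
at zero and has, for every positive mass tuple, bare masses on the physical branch and a
volume-uniform full-spectrum lattice gap Δ(m), then QCD — continuum limit of the smeared glue /
pseudoscalar lattice Schwinger functions along that regularisation, or along a CHIRALITY-PRESERVING
diagonal subsequence (¬HasLatticeMassGap ε is `∃ A B, ∀ C, frequently in k`: keep infinitely many
violating k for each (ε_j = 1/j, C = j) — countable bookkeeping; scaling, branch and gap clauses
pass to subsequences for free), to OS data that are IsQCDAlong, non-trivial and non-Gaussian in
glue, with dynamical quarks, inheriting the gap (Δ′ ≤ Δ(m); the lattice clause does not read z,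
shift and is antitone in the rate); HasMassScaling and IsChiralAtZero are handed to the conjunct's
reg verbatim. This route does not attack existence; it supplies the chiral lattice half
thermodynamically. [deps: ColdInfraredGap] [difficulty: open-problem] (why it might fail: a chiral
lattice gap is not convergence: fermionic UV stability / tightness with LIGHT quarks (m → 0⁺ is
inside), E1 rotations of a subsequential Wilson-lattice limit (RegularisationDichotomy,
UVStabilityNonUniqueness), IsNonGaussian glue under the ψ̄ψ-mixing caveat, and the
chirality-preserving choice of subsequence can each fail with the hypothesis true.)
[JaffeWitten2000, OsterwalderSeiler1978, Balaban1988Convergent, MontvayMunster1994,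
Literature.Barriers.QuantumFields.RegularisationDichotomy,
Literature.Barriers.QuantumFields.UVStabilityNonUniqueness]
#— Repair log (2026-08-16, statement re-type p117723): dropped from this route: ColdCertificate
stmt-QuantumFields-10192 (threshold form, superseded by #3), OffsetToFull stmt-QuantumFields-9529
(threshold shift, PROVED by Theorems.offsetToFull_proof and still true, but moot: shifting m_crit by
M₀ > 0 of a reg gapped above M₀ yields a reg that is provably NOT chiral at zero —
Negative.ChiralityObstruction.not_isChiralAtZero_mcrit_shift_of_uniformGapAbove — so it cannot feed
the re-typed conjunct) and ContinuumComplement stmt-QuantumFields-9643 (non-chiral lattice half →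
QCD would now smuggle the chirality clause into the UV complement; replaced by #5). Both shared
items keep their other route. ThetaPlusTransport and ColdInfraredGap are untouched (universal over
regularisations; `closes` feeds them the chiral reg).
#9 StrongCouplingAnchor (support) — (card P2, the solvable corner; calibration for provers and
refuters, off the assembly chain) for N_f ∈ {2,3} there are β₀ > 0 and a bare-mass threshold M
(heavy quarks, small hopping parameter) such that for all 0 < β ≤ β₀ and all m_f ≥ M: the spatial
thermodynamic limits φ(N_t) of the thermal free energy per site and e₀ = lim φ exist, Θ⁺ holds on
the whole range N_t ≥ 2 (N ≤ N' ⇒ N'⁴(e₀ − φ(N')) ≤ N⁴(e₀ − φ(N))), and N_t⁴(e₀ − φ(N_t)) → 0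
(cold): the Osterwalder–Seiler strong-coupling/hopping cluster expansion re-derived
thermodynamically, thermal corrections being sums over polymers winding the time circle (gluon tubes
u(β)^{4N_t}, quark loops κ^{N_t}) with positive character coefficients; the card's kit toys (free
lattice scalar and r = 1 Wilson fermion monotone for N_t ≥ 2, violated at N_t = 1; SU(3) leading
strong-coupling term monotone for u ≤ e^{−3/4}) are its zeroth order. [difficulty: L]
[OsterwalderSeiler1978, Seiler1982, MontvayMunster1994, doi:10.1016/0550-3213(96)00170-8]

TWO-LAYER PLAN. Foreseen glued splits once a crux closes (none filed now; k ≤ 3, depth 1):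
ThetaPlusTransport ⇐ LimitOfCertificate (F^fin(N₁,N_s) →
F(N₁), provable now) → ThetaPlusSign (N_t ↦ F_k(N_t) antitone on the cold range: the sign conjecture
proper) → ThetaPlusTransport;
ColdInfraredGap ⇐ ColdImpliesSpectralGap (cold below T₁ ⇒ transfer-matrix gap ≥ x(η)T₁a_k in every
sector, the IR-minimality content)
→ SpectralGapToClustering (Lüscher positivity + wrap-around bookkeeping ⇒ HasLatticeMassGap,
provable with work) → ColdInfraredGap;
ChiralColdCertificate ⇐ PinnedCertificate (∃ reg₀, ∃ P: thermodynamic limits + one-temperature bound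
for all m > P, AND gapless-at-every-rate points just above P —
a Goldstone two-point LOWER bound, cf. in-tree isChiralAtZero_of_goldstone) → PinShift (shift m_crit
by P: thresholdShift_generic + isChiralAtZero_mcrit_shift_iff,
provable now) → ChiralColdCertificate; alternatively the chirality clause splits thermodynamically
(HotNearChiral: for every T some positive tuple is hot at T,
+ GapImpliesCold: a uniform lattice gap ε forces F < 1 below c·ε — the easy direction of the gap ⟺
cold dictionary, modulo density-of-states control).

KILL CRITERIA. Refutation of ThetaPlusTransport — a cold (F < 1), non-degenerate zero-density point
of lattice SU(3) with N_f ∈ {0 heavy-limit, 2, 3}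
Wilson quarks at which p/T⁴ DEcreases toward lower T (equivalently ⟨s⟩_{N_t} > ⟨s⟩_∞ or (ε−3p) < 0
beyond errors below T_c at
N_t ≥ 2), or a theorem ¬ThetaPlusTransport in any corner — closes the route
`refuted:ThetaPlusTransport` unless the failure needs η
close to 1, in which case pivot: restate with "∃ η₀ > 0, ∀ η ≤ η₀". Refutation of ColdInfraredGap —
a unitary interacting 4D CFT with
c_therm below 1 free boson reachable as an infrared of an RP lattice gauge theory, or any cold
gapless RP lattice infrared — closes the
route `refuted:ColdInfraredGap` (the inversion's classification is then wrong and the card dies with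
it). ChiralColdCertificate is ∃-form and
dies only with QCD itself (¬IsChiralAtZero for every honest regularisation — massless N_f = 2, 3
Wilson-lattice QCD uniformly gapped — would be a
statement-level event for the re-typed conjunct, not a route kill). A chiral FullLatticeGap proved
elsewhere moots K1–K3 (the route then merely
re-certifies); ChiralContinuumComplement refuted breaks every lattice-first route at once.

NOT DECOMPOSED YET. The four faces of Θ⁺ and their equivalences (Legendre: σ(e)/e^{3/4} monotone ⟺ ε
≥ 3p; β-twin ∂_β F ∝ ⟨s⟩_∞ − ⟨s⟩_{N_t}; Feynman–Hellmann
deficit; specific-heat dominance) — layer-2 children of ThetaPlusTransport once someone claims it;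
the dictionary lemmas (RP ⇒ F ≥ 0 and
Π(N_t) = log Tr𝒯^{N_t} − N_t log λ₀ convex non-increasing; single-species bound M ≥ x(η)T₁; Lüscher
finite-size vacuum-energy shifts)
— children of ColdInfraredGap / ChiralColdCertificate; existence of the thermodynamic limits and the
Goldstone lower bound behind IsChiralAtZero (both inside
ChiralColdCertificate until the PinnedCertificate/PinShift split is filed); the value of T₁(m) and
η; the N_f = 0 twin of the whole chain for the YangMills conjunct (a separate route if wanted).
Constants (x(η), the 6.3 degeneracy
threshold) stay in docstrings until a child needs them.

CHEAPEST FALSIFIER. The sign of Δ⟨s⟩ = ⟨s⟩_{N_t} − ⟨s⟩_∞ (the integrand of the lattice integral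
method, = −(π²/90) N_t⁻⁴ ∂_β F) at COLD zero-density points:
published SU(3) data (Boyd et al. 1996, N_t = 4, 6, 8; Borsányi et al. 2012 incl. the confined tail
where (ε−3p)/T⁴ ~ 10⁻³; HotQCD 2014
and WB for 2+1 flavours) show it ≥ 0 everywhere measured — one significant negative cold point kills
ThetaPlusTransport. Already run by
the card's author (kit j000903, j000943): 2D Ising cylinder n²(f_∞ − f_n) non-increasing for all n ≥
2 at every K incl. K_c; 4D free
scalar (m ∈ {0, 0.1, 0.3, 1}) and r = 1 Wilson fermion: N_t⁴ p monotone ↘ for N_t ≥ 2 (violated only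
at N_t = 1), Richardson-refined to
N_t = 48; SU(3) leading strong-coupling term monotone for u ≤ 0.5. Next cheapest (not run; needs a
small Monte Carlo): SU(2)/SU(3) pure
gauge at N_t = 2, 3 and intermediate β below β_c(N_t), where no plaquette-difference data are
published. For ColdInfraredGap: a
literature check of the smallest known c_therm/c_free among unitary 4D CFTs (N = 4 SYM at strong
coupling: 3/4; Banks–Zaks: ≈ 1).

NUMBERS. F in free-boson units: photon gas 2; N_f = 2 pions 3; pure-glue plasma 16, QGP 16 + 10.5
N_f; single boson of mass M at M/T = 1, 2, 3,
5: 0.78, 0.47, 0.26, 0.061 (F(x) = (45/π⁴) x² Σ_n K₂(nx)/n²); SU(3) confined side p/T⁴(T_c⁻) ≈ 0.02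
⇒ F ≈ 0.18 (arXiv:1204.6184); physical
2+1 QCD at T = 150 MeV: p/T⁴ ≈ 0.35 ⇒ F ≈ 3 > 1 (light pions: certificate must sit at T₁ ≲ m_π/4,
where three pions give F ≈ 0.25);
degeneracy signal at aspect ratio 1: n vacua ⇒ F^fin(N, N) ≥ (90/π²) log n ≥ 6.3; Θ⁺ fails at N_t =
1 in every free toy and holds for
N_t ≥ 2 (kit j000903/j000943); 2D anchor: c ∈ {0} ∪ [1/2, ∞) (FQS), c_therm = c (Cardy/Affleck).
Items at open: 7 (4 cruxes, 2 support, 1 assembly); after the repair of 2026-08-16: 6 (4 cruxes, 1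
support, 1 assembly).

DEFINITION REQUESTS. None blocking: the thermal objects (sites, shifts, link configurations,
plaquettes, Wilson weight, product Haar measure) are typed inline over Mathlib +
`haarProbability`, `fundamentalRep`, `euclideanGamma`, `GrassmannAlgebra.berezin`, `grassmannExp`,
`quadratic` — all inside the import closure of the QCD Statement,
so the route file imports no Literature module of its own (cone repair 2026-08-15; same pattern as
route CentreStabilisedCircle).
Wanted for readability and sharing with CentreStabilisedCircle / any YangMills thermal route (filed
after open as a definition item):
`qcdThermalPartition Nf Nt Ns β mq` (Wilson SU(3) + N_f antiperiodic Wilson quarks on ℤ_{N_t} ×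
ℤ_{N_s}³, signed Berezin determinant)
and `thermalFreeEnergyDensity`, topic Literature/MathematicalPhysics/QuantumFieldTheory, with the
lemma Z_AP = Tr 𝒯^{N_t} > 0 for
m_f > −1 (Luscher1977) as its first fact.

Novelty: Searches (2026-08-15; searchd down for remote cascades, rc 75): `lit search --hybrid "interaction
measure trace anomaly non-negative
pressure over T^4 monotonic confinement mass gap"` (12 book rows, vector leg only: Montvay–Münster,
Greensite, DMS — textbook
thermodynamics/CFT, nothing joining d.o.f. counting to the gap); `lit galaxy search --star all` ×3
("free energy monotonic in
temperature degrees of freedom" 0, "thermal c-theorem" 0, "Appelquist-Cohen-Schmaltz" 1: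
panama:362555369324607 SCGT proceedings —
conformal-window use of the ACS inequality); the card's own audit searches (vsearch ×4, galaxy ×3 +
pdf intelligent ×1 → 25 EoS rows,
none gap-directed; `lit read arxiv:hep-th/9901109` pp. 5–8; arXiv:2207.06753 p. 4; `lit frontier
QuantumFields --since 2020` 30 rows,
nothing thermodynamic); all 22 QCD and 17 YangMills route files of this summit read by thesis (none
thermal-transport).
Nearest prior art found: doi:10.1103/physrevd.60.045003 (ACS 1999: defines F, endpoint inequality
f_IR ≤ f_UV, monotonicity discussed
and rejected as a general thermal c-theorem with an IR-free counterexample, used for phase structure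
— never for the gap);
arXiv:2207.06753 (FFMP 2022: ⟨Θ⟩_T ≥ 0 conjectured/assumed in continuum form); pool card
QuantumFields/YangMills/pressure-boltzmann-gap-criterion (closed, variant: gap ⟺ cold pressure,
declined for having no continuation in L);
doi:10.1016/0550-3213(96)00170-8 (Boyd et al.: Δ⟨S⟩ ≥ 0 observed, the integral method's integrand);
doi:10.1016  [refs: 10.1103/physrevd.60.045003, 10.1016/0550-3213(96, 10.1016/0550-3213(91, hep-th/9901109, 2207.06753, arxiv:hep-th/9901109, doi:10.1103/physrevd.60.045003, doi:10.1016/0550-3213]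

Barriers (technique_class: thermodynamic-transport, RP, dof-counting): - technique_class: thermodynamic-transport, RP, dof-counting
- Literature.Barriers.QuantumFields.FiniteTemperatureDeconfinement: evaded — Borgs–Seiler
deconfinement is at FIXED L_t as β → ∞; here β_k is fixed and L_t ≥ N₁(k) → ∞ (downward in T), the
certificate sits at T₁ below deconfinement by construction, and no claim is made at small L_t where
F is large.
- Literature.Barriers.QuantumFields.CenterSymmetryBreakingByQuarks: not in class — no Polyakov loop
or centre-sensitive quantity is used; dynamical quarks enter only through the antiperiodic thermal
trace, which exists for any N_f.
- Literature.Barriers.QuantumFields.AbelianDeconfinementD4: met where it must be — U(1)₄'s Coulomb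
phase is hot (photon gas, F = 2), so ColdCertificate is false for U(1) at weak coupling and the
chain is group-sensitive through one measured number; conceded that ThetaPlusTransport alone may
hold for U(1) too.
- Literature.Barriers.QuantumFields.UVStabilityNonUniqueness: it does not evade it; the bet is that
ONE free-energy difference at ONE temperature, to precision η(π²/90)N₁⁻⁴ per site, is the cheapest
last-scale evaluation any route can ask for (ColdCertificate's why-might-fail says so).
- Literature.Barriers.QuantumFields.PerturbativeInvisibility: respected — Δ comes out of a
non-perturbative certificate at T₁ ~ Λ; perturbation theory enters only the deconfined sanity checks
of Θ⁺, which the cold premise excludes from the claims.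
- Literature.Barriers.QuantumFields.WilsonDeterminantSign: n

History (route lifecycle, newest last):
- 2026-08-16T23:18:14Z · rev 5: restated Assembly (stmt-QuantumFields-10195) — route-repair p117723 step 3/4: Assembly restated to the re-glued chain (ColdCertificate/OffsetToFull/ContinuumComplement leave the chain; they are dropped from (planner-rrepair-QuantumFields-CounterexampleMu-af4ae310-0)
- 2026-08-16T23:20:24Z · rev 6: dropped ColdCertificate, ContinuumComplement, OffsetToFull — route-repair p117723 step 4/4: drop ColdCertificate / ContinuumComplement (shared, stays with CentreStabilisedCircle) / OffsetToFull (proved, moot) from this ro (planner-rrepair-QuantumFields-CounterexampleMu-af4ae310-0)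
- 2026-08-17T03:12:53Z · rev 12: restated Assembly (stmt-QuantumFields-17389) — strategist: Assembly item restated to the type of the re-glued closes (rev 10): pieces of ChiralColdCertificate replace it in the chain (planner-cstrat-stmt-QuantumFields-17303-r1-0)
- 2026-08-25T03:36:26Z · DORMANT — reconciler: no traction for 7.3 d (last activity item-evidence-added at 2026-08-17T18:58:07Z); parked, not closed — `ledger route dormant route-QuantumFields-Co (operator:999:3047565)
- 2026-08-28T21:13:49Z · REACTIVATED — reconciler: reactivated — activity statement-closed at 2026-08-28T18:50:31Z after parking at 2026-08-25T03:36:26Z (operator:999:2160103)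
- 2026-08-30T01:42:15Z · DORMANT — rlead D-0179: BLOCKER=stmt-QuantumFields-18758 ≡ L (CostumeSandwich.costume_iff / BlockerNode rc 0); reduces-to L ∧ (L→QCD); ∀-laws 10191/18760/10193/18759 kept (planner-rlead-qf-CounterexampleMustBeHot-g2-0)

sub-problem: QCD · status: dormant · opened planner-plancard-QuantumFields-QCD-counterexa-241d83fd-0 2026-08-15T15:18:59Z · rev 15 · ledger route-QuantumFields-CounterexampleMustBeHot
GENERATED by the gate from the ledger (D-0016/17). Provers cite these decls: `theorem foo : Summit.QuantumFields.QCD.Theses.CounterexampleMustBeHot.<Decl> := …` in Summits/QuantumFields/QCD/Theorems/<Name>.lean.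
-/

namespace Summit.QuantumFields.QCD.Theses.CounterexampleMustBeHot

open scoped BigOperators Topology Manifold Classical MeasureTheory ProbabilityTheory Matrix InnerProductSpace ComplexConjugate ContinuousMap
open Filter Set Function TopologicalSpace MeasureTheory

attribute [summit_statement] _root_.QCD

/-! Retired items kept as plain definitions (history; not obligations of this route): landed proofs / closed glue still name them. -/

/-- retired stmt-QuantumFields-9529 (dropped, gen None) — proved by Summit.QuantumFields.QCD.Theorems.offsetToFull_proof. -/
def OffsetToFull : Prop :=
  (∀ Nf : ℕ, Nf = 2 ∨ Nf = 3 → ∃ reg : Literature.MathematicalPhysics.QuantumFieldTheory.QCDRegularisation Nf, reg.HasMassScaling ∧ (reg.scheme 0 0 0).HasAsymptoticScaling ∧ ∃ M₀ : ℝ, 0 ≤ M₀ ∧ ∀ m : Fin Nf → ℝ, (∀ f, M₀ < m f) → (∀ f, ∀ᶠ k in Filter.atTop, -1 < (reg.scheme m 0 0).mq f k) ∧ ∃ Δ : ℝ, 0 < Δ ∧ (reg.scheme m 0 0).HasLatticeMassGap Δ) → ∀ Nf : ℕ, Nf = 2 ∨ Nf = 3 → ∃ reg : Literature.MathematicalPhysics.QuantumFieldTheory.QCDRegularisation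 Nf, reg.HasMassScaling ∧ (reg.scheme 0 0 0).HasAsymptoticScaling ∧ ∀ m : Fin Nf → ℝ, (∀ f, 0 < m f) → (∀ f, ∀ᶠ k in Filter.atTop, -1 < (reg.scheme m 0 0).mq f k) ∧ ∃ Δ > 0, (reg.scheme m 0 0).HasLatticeMassGap Δ

/-- item stmt-QuantumFields-10191 · crux · rank 2 · open · by planner
why it might fail: ε−3p ≥ 0 (p/T⁴ non-decreasing) is proved only for free massive gases and leading strong coupling, N_t ≥ 2; ACS (hep-th/9901109 pp. 6–8) show non-monotone f(T) in IR-free phases (hot, excluded by the premise); ∀ over reg, m, η<1, T₁: one cold non-degenerate point with ⟨s⟩_{N_t} > ⟨s⟩_∞ refutes it.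
sources: AppelquistCohenSchmaltz1999, BoydEtAl1996, BorsanyiEtAl2012, BazavovEtAl2014, FujimotoEtAl2022, GerberLeutwyler1989
[crux] (card K1, Θ⁺ restricted to the cold regime) for N_f ∈ {2,3}, EVERY regularisation reg with
leading-log mass scaling and two-loop asymptotic scaling, every mass tuple m whose bare trajectory
stays on the physical branch m_f(k) > −1, all limit functions φ, e₀ satisfying `Lim`, every η < 1
and T₁ > 0: IF the finite-volume certificate holds (eventually in k, F^fin_k(N₁(k), N_s) ≤ η for all
N_s ≥ N₁(k) = ⌈1/(a_k T₁)⌉) THEN eventually in k, F_k(N') ≤ η for every N' ≥ N₁(k) — coldness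
certified at temperature T₁ persists at all lower temperatures. Intended proof: F^fin(N₁, N_s) →
F(N₁) as N_s → ∞, then Θ⁺: N_t ↦ F_k(N_t) is non-increasing on [N₁(k), ∞) (four equivalent faces:
microcanonical σ(e)/e^{3/4} non-decreasing; the thermal circle orders the plaquette, ⟨s⟩_{N_t} ≤
⟨s⟩_∞; Boltzmann-averaged Feynman–Hellmann action deficit ≤ 0; specific-heat stochastic dominance).
The cold premise removes exactly the known non-monotone class (infrared-free gauge phases are hot, F
≥ 2) and all hot/deconfined points. [difficulty: open-problem] -/
@[route_item "route-QuantumFields-CounterexampleMustBeHot", crux]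
def ThetaPlusTransport : Prop :=
  open Literature.MathematicalPhysics.QuantumLattice Literature.MathematicalPhysics.QuantumFieldTheory in ∀ Nf : ℕ, Nf = 2 ∨ Nf = 3 → let ρ := fundamentalRep (Fin 3); let St : ℕ → ℕ → Type := fun Nt Ns => ZMod Nt × (Fin 3 → ZMod Ns); let shift : ∀ (Nt Ns : ℕ), St Nt Ns → Option (Fin 3) → St Nt Ns := fun _ _ x μ => Option.elim μ (x.1 + 1, x.2) fun i => (x.1, x.2 + Pi.single i 1); let Cfg : ℕ → ℕ → Type := fun Nt Ns => St Nt Ns × Option (Fin 3) → Matrix.specialUnitaryGroup (Fin 3) ℂ; let plaq : ∀ (Nt Ns : ℕ), Cfg Nt Ns → St Nt Ns → Option (Fin 3) → Option (Fin 3) → Matrix.specialUnitaryGroup (Fin 3) ℂ := fun Nt Ns U x μ ν => U (x, μ) * U (shift Nt Ns x μ, ν) * (U (shift Nt Ns x ν, μ))⁻¹ * (U (x, ν))⁻¹; let wt : ∀ (Nt Ns : ℕ) [NeZero Nt] [NeZero Ns], ℝ → Cfg Nt Ns → ℝ := fun Nt Ns _ _ β U => Real.exp (β * ∑ x : St Nt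 Ns, ∑ i : Fin 3, (ρ (plaq Nt Ns U x none (some i))).trace.re + β * ∑ x : St Nt Ns, ∑ p : {p : Fin 3 × Fin 3 // p.1 < p.2}, (ρ (plaq Nt Ns U x (some p.1.1) (some p.1.2))).trace.re); let μH : ∀ (Nt Ns : ℕ) [NeZero Nt] [NeZero Ns], MeasureTheory.Measure (Cfg Nt Ns) := fun Nt Ns _ _ => MeasureTheory.Measure.pi fun _ : St Nt Ns × Option (Fin 3) => haarProbability (Matrix.specialUnitaryGroup (Fin 3) ℂ); let V : ℕ → ℕ → Type := fun Nt Ns => Fin Nf × (St Nt Ns × Fin 3 × Fin 4); let I : ∀ (Nt Ns : ℕ) [NeZero Nt] [NeZero Ns], Type := fun Nt Ns _ _ => Fin (Fintype.card (V Nt Ns)); let D : ∀ (Nt Ns : ℕ) [NeZero Nt] [NeZero Ns], Cfg Nt Ns → (Fin Nf → ℝ) → Matrix (I Nt Ns) (I Nt Ns) ℂ := fun Nt Ns _ _ U mq => let e := Fintype.equivFin (V Nt Ns); Matrix.reindex e e (Matrix.of fun v w : Fin Nf × (St Nt Ns × Fin 3 × Fin 4) => if v.1 = w.1 then ((if v.2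 = w.2 then ((mq v.1 + 4 : ℝ) : ℂ) else 0) - 2⁻¹ * ∑ μ : Option (Fin 3), let sgn : St Nt Ns → ℂ := fun x => if μ = none ∧ x.1 = -1 then -1 else 1; ((if w.2.1 = shift Nt Ns v.2.1 μ then sgn v.2.1 * ((1 - euclideanGamma (μ.elim 3 Fin.castSucc)) v.2.2.2 w.2.2.2 * ρ (U (v.2.1, μ)) v.2.2.1 w.2.2.1) else 0) + (if v.2.1 = shift Nt Ns w.2.1 μ then sgn w.2.1 * ((1 + euclideanGamma (μ.elim 3 Fin.castSucc)) v.2.2.2 w.2.2.2 * ρ ((U (w.2.1, μ))⁻¹) v.2.2.1 w.2.2.1) else 0))) else 0); let Z : ∀ (Nt Ns : ℕ) [NeZero Nt] [NeZero Ns], ℝ → (Fin Nf → ℝ) → ℂ := fun Nt Ns _ _ β mq => MeasureTheory.integral (μH Nt Ns) fun U => GrassmannAlgebra.berezin ℂ _ (grassmannExp (quadratic ℂ (-D Nt Ns U mq))) * ((wt Nt Ns β U : ℝ) : ℂ); let f : ∀ (Nt Ns : ℕ) [NeZero Nt] [NeZero Ns], ℝ → (Fin Nf → ℝ) → ℝ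 := fun Nt Ns _ _ β mq => -Real.log ‖Z Nt Ns β mq‖ / ((Nt : ℝ) * (Ns : ℝ) ^ 3); let Lim : QCDScheme Nf → (ℕ → ℕ → ℝ) → (ℕ → ℝ) → Prop := fun sch φ e₀ => (∀ (k Nt : ℕ) [NeZero Nt], Filter.Tendsto (fun Ns : ℕ => f Nt (Ns + 1) (sch.β k) (fun fl => sch.mq fl k)) Filter.atTop (nhds (φ k Nt))) ∧ ∀ k : ℕ, Filter.Tendsto (φ k) Filter.atTop (nhds (e₀ k)); let F : (ℕ → ℕ → ℝ) → (ℕ → ℝ) → ℕ → ℕ → ℝ := fun φ e₀ k Nt => 90 / Real.pi ^ 2 * (Nt : ℝ) ^ 4 * (e₀ k - φ k Nt); let Ffin : QCDScheme Nf → (ℕ → ℝ) → ℕ → ∀ (Nt Ns : ℕ) [NeZero Nt] [NeZero Ns], ℝ := fun sch e₀ k Nt Ns _ _ => 90 / Real.pi ^ 2 * (Nt : ℝ) ^ 4 * (e₀ k - f Nt Ns (sch.β k) (fun fl => sch.mq fl k)); let ColdFin : QCDScheme Nf → (ℕ → ℝ) → ℝ → ℝ → Prop := fun sch e₀ η T₁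 => ∀ᶠ k in Filter.atTop, ∀ (Nt : ℕ) [NeZero Nt], Nt = ⌈(sch.a k * T₁)⁻¹⌉₊ → ∀ (Ns : ℕ) [NeZero Ns], Nt ≤ Ns → Ffin sch e₀ k Nt Ns ≤ η; let ColdBelow : QCDScheme Nf → (ℕ → ℕ → ℝ) → (ℕ → ℝ) → ℝ → ℝ → Prop := fun sch φ e₀ η T₁ => ∀ᶠ k in Filter.atTop, ∀ N' : ℕ, ⌈(sch.a k * T₁)⁻¹⌉₊ ≤ N' → F φ e₀ k N' ≤ η; ∀ reg : QCDRegularisation Nf, reg.HasMassScaling → (reg.scheme 0 0 0).HasAsymptoticScaling → ∀ m : Fin Nf → ℝ, (∀ fl : Fin Nf, ∀ᶠ k in Filter.atTop, -1 < (reg.scheme m 0 0).mq fl k) → ∀ (φ : ℕ → ℕ → ℝ) (e₀ : ℕ → ℝ), Lim (reg.scheme m 0 0) φ e₀ → ∀ η : ℝ, η < 1 → ∀ T₁ : ℝ, 0 < T₁ → ColdFin (reg.scheme m 0 0) e₀ η T₁ → ColdBelow (reg.scheme m 0 0) φ e₀ η T₁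

/-- item stmt-QuantumFields-18758 · crux · rank 3 · open · by planner
why it might fail: COLD needs log‖Z_AP‖ to absolute precision η(π²/90)N₁⁻⁴ per site uniformly in k and N_s ≥ N₁, at T₁(m) → 0 as m → 0⁺ — beyond Balaban UV stability; HOT needs a k-uniform Goldstone-gas LOWER bound on the pressure near κ_c(β_k). Neither exists for any 4d gauge theory.
sources: Balaban1988Convergent, Literature.Barriers.QuantumFields.UVStabilityNonUniqueness, Luscher1977, GerberLeutwyler1989, AppelquistCohenSchmaltz1999, SharpeSingleton1998
[crux] (piece 1/3 of the typed decomposition ColdHotWitness → FreeEnergyLimits → GapImpliesCold →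
ChiralColdCertificate of the RESTATED deciding crux stmt-QuantumFields-17303 — glue: support
ChiralColdCertificateOfSplit, proved sorry-free; BC2 redirect, crux-strategist r1 2026-08-17, filed
as items because `--split` is refused to this seat: the parent is the ASSEMBLY node of the three
pieces and is to be attacked through them; the ONLY existential piece — purely THERMODYNAMIC: every
clause is about the thermal free energy per site f_k(N_t,N_s) = −log‖Z_AP‖/(N_t N_s³) of Wilson
SU(3) + N_f time-antiperiodic Wilson quarks; no correlator, no OS datum, no gap) for N_f = 2 and 3
there is ONE mass-independent regularisation reg (HasMassScaling, two-loop HasAsymptoticScaling)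
with non-negative bare couplings β_k ≥ 0 and critical bare masses on the Lüscher-positive branch
m_crit(k) > −1 at EVERY k (so every positive tuple has κ_f(k) < 1/6 at every k, where Z_AP = Tr
𝒯^{N_t} > 0; honest witnesses start at weak enough coupling, κ_c(β_k) < 1/6) such that (COLD) for
every positive mass tuple m there are η < 1 and a temperature T₁ = T₁(m) > 0 with: whenever
thermodynamic limits φ_k(N_t), e₀(k) -/
@[route_item "route-QuantumFields-CounterexampleMustBeHot", crux]
def ColdHotWitness : Prop :=
  open Literature.MathematicalPhysics.QuantumLattice Literature.MathematicalPhysics.QuantumFieldTheory in ∀ Nf : ℕ, Nf = 2 ∨ Nf = 3 → let ρ := fundamentalRep (Fin 3); let St : ℕ → ℕ → Type := fun Nt Ns => ZMod Nt × (Fin 3 → ZMod Ns); let shift : ∀ (Nt Ns : ℕ), St Nt Ns → Option (Fin 3) → St Nt Ns := fun _ _ x μ => Option.elim μ (x.1 + 1, x.2) fun i => (x.1, x.2 + Pi.single i 1); let Cfg : ℕ → ℕ → Type := fun Nt Ns => St Nt Ns × Option (Fin 3) → Matrix.specialUnitaryGroup (Fin 3) ℂ; let plaq : ∀ (Nt Ns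 : ℕ), Cfg Nt Ns → St Nt Ns → Option (Fin 3) → Option (Fin 3) → Matrix.specialUnitaryGroup (Fin 3) ℂ := fun Nt Ns U x μ ν => U (x, μ) * U (shift Nt Ns x μ, ν) * (U (shift Nt Ns x ν, μ))⁻¹ * (U (x, ν))⁻¹; let wt : ∀ (Nt Ns : ℕ) [NeZero Nt] [NeZero Ns], ℝ → Cfg Nt Ns → ℝ := fun Nt Ns _ _ β U => Real.exp (β * ∑ x : St Nt Ns, ∑ i : Fin 3, (ρ (plaq Nt Ns U x none (some i))).trace.re + β * ∑ x : St Nt Ns, ∑ p : {p : Fin 3 × Fin 3 // p.1 < p.2}, (ρ (plaq Nt Ns U x (some p.1.1) (some p.1.2))).trace.re); let μH : ∀ (Nt Ns : ℕ) [NeZero Nt] [NeZero Ns], MeasureTheory.Measure (Cfg Nt Ns) := fun Nt Ns _ _ => MeasureTheory.Measure.pi fun _ : St Nt Ns × Option (Fin 3) => haarProbability (Matrix.specialUnitaryGroup (Fin 3) ℂ); let V : ℕ → ℕ → Type := fun Nt Ns => Fin Nf × (St Nt Ns × Fin 3 × Fin 4); let I : ∀ (Nt Ns : ℕ) [NeZero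 Nt] [NeZero Ns], Type := fun Nt Ns _ _ => Fin (Fintype.card (V Nt Ns)); let D : ∀ (Nt Ns : ℕ) [NeZero Nt] [NeZero Ns], Cfg Nt Ns → (Fin Nf → ℝ) → Matrix (I Nt Ns) (I Nt Ns) ℂ := fun Nt Ns _ _ U mq => let e := Fintype.equivFin (V Nt Ns); Matrix.reindex e e (Matrix.of fun v w : Fin Nf × (St Nt Ns × Fin 3 × Fin 4) => if v.1 = w.1 then ((if v.2 = w.2 then ((mq v.1 + 4 : ℝ) : ℂ) else 0) - 2⁻¹ * ∑ μ : Option (Fin 3), let sgn : St Nt Ns → ℂ := fun x => if μ = none ∧ x.1 = -1 then -1 else 1; ((if w.2.1 = shift Nt Ns v.2.1 μ then sgn v.2.1 * ((1 - euclideanGamma (μ.elim 3 Fin.castSucc)) v.2.2.2 w.2.2.2 * ρ (U (v.2.1, μ)) v.2.2.1 w.2.2.1) else 0) + (if v.2.1 = shift Nt Ns w.2.1 μ then sgn w.2.1 * ((1 + euclideanGamma (μ.elim 3 Fin.castSucc)) v.2.2.2 w.2.2.2 * ρ ((U (w.2.1, μ))⁻¹) v.2.2.1 w.2.2.1) else 0)))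 else 0); let Z : ∀ (Nt Ns : ℕ) [NeZero Nt] [NeZero Ns], ℝ → (Fin Nf → ℝ) → ℂ := fun Nt Ns _ _ β mq => MeasureTheory.integral (μH Nt Ns) fun U => GrassmannAlgebra.berezin ℂ _ (grassmannExp (quadratic ℂ (-D Nt Ns U mq))) * ((wt Nt Ns β U : ℝ) : ℂ); let f : ∀ (Nt Ns : ℕ) [NeZero Nt] [NeZero Ns], ℝ → (Fin Nf → ℝ) → ℝ := fun Nt Ns _ _ β mq => -Real.log ‖Z Nt Ns β mq‖ / ((Nt : ℝ) * (Ns : ℝ) ^ 3); let Lim : QCDScheme Nf → (ℕ → ℕ → ℝ) → (ℕ → ℝ) → Prop := fun sch φ e₀ => (∀ (k Nt : ℕ) [NeZero Nt], Filter.Tendsto (fun Ns : ℕ => f Nt (Ns + 1) (sch.β k) (fun fl => sch.mq fl k)) Filter.atTop (nhds (φ k Nt))) ∧ ∀ k : ℕ, Filter.Tendsto (φ k) Filter.atTop (nhds (e₀ k)); let F : (ℕ → ℕ → ℝ) → (ℕ → ℝ) → ℕ → ℕ → ℝ := fun φ e₀ k Nt => 90 / Real.pi ^ 2 * (Nt :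 ℝ) ^ 4 * (e₀ k - φ k Nt); let Ffin : QCDScheme Nf → (ℕ → ℝ) → ℕ → ∀ (Nt Ns : ℕ) [NeZero Nt] [NeZero Ns], ℝ := fun sch e₀ k Nt Ns _ _ => 90 / Real.pi ^ 2 * (Nt : ℝ) ^ 4 * (e₀ k - f Nt Ns (sch.β k) (fun fl => sch.mq fl k)); let ColdFin : QCDScheme Nf → (ℕ → ℝ) → ℝ → ℝ → Prop := fun sch e₀ η T₁ => ∀ᶠ k in Filter.atTop, ∀ (Nt : ℕ) [NeZero Nt], Nt = ⌈(sch.a k * T₁)⁻¹⌉₊ → ∀ (Ns : ℕ) [NeZero Ns], Nt ≤ Ns → Ffin sch e₀ k Nt Ns ≤ η; ∃ reg : QCDRegularisation Nf, reg.HasMassScaling ∧ (reg.scheme 0 0 0).HasAsymptoticScaling ∧ (∀ k : ℕ, 0 ≤ reg.β k) ∧ (∀ k : ℕ, -1 < reg.mcrit k) ∧ (∀ m : Fin Nf → ℝ, (∀ fl, 0 < m fl) → ∃ η : ℝ, η < 1 ∧ ∃ T₁ : ℝ, 0 < T₁ ∧ ∀ (φ : ℕ → ℕ → ℝ) (e₀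 : ℕ → ℝ), Lim (reg.scheme m 0 0) φ e₀ → ColdFin (reg.scheme m 0 0) e₀ η T₁) ∧ ∃ θ : ℝ, 0 < θ ∧ ∀ T : ℝ, 0 < T → ∃ m : Fin Nf → ℝ, (∀ fl, 0 < m fl) ∧ ∀ (φ : ℕ → ℕ → ℝ) (e₀ : ℕ → ℝ), Lim (reg.scheme m 0 0) φ e₀ → ∃ᶠ k in Filter.atTop, θ ≤ F φ e₀ k ⌈((reg.scheme m 0 0).a k * T)⁻¹⌉₊

/-- item stmt-QuantumFields-10193 · crux · rank 4 · open · by planner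
why it might fail: 'Cold ⇒ uniformly gapped' needs all gapless lattice IRs of SU(3)+2,3 Wilson quarks hot: open for interacting 4D CFTs (only f_therm>0 known, arXiv:2306.08031 p.5) and non-Lorentz/generalised-free IRs; k-uniform clustering on (−1)^F-periodic tori from thermal data needs K<1/6 RP + wrap-around bounds.
sources: AppelquistCohenSchmaltz1999, FriedanQiuShenker1984, Cardy1986OperatorContent, arXiv:2306.08031, SharpeSingleton1998, Creutz2003
[crux] (card K3, IR-minimality made a lattice lemma) for N_f ∈ {2,3}, every reg (mass scaling,
asymptotic scaling), every mass tuple on the physical branch, all φ, e₀ with `Lim`, every η < 1, T₁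
> 0: IF the finite-volume certificate at N₁(k) holds (aspect ratios ≥ 1) AND F_k(N') ≤ η for all N'
≥ N₁(k), both eventually in k, THEN ∃ Δ > 0 with `(reg.scheme m 0 0).HasLatticeMassGap Δ` (all
gauge-invariant local observables, all tori ≥ the scheme's, uniformly in the volume; the thermal
trace counts every flavour/baryon sector, so nothing is certified on a sub-space). Content: (i)
quantisation of free/Goldstone/photon infrareds (hypercubic symmetry ⇒ unit velocity ⇒ F_IR ≥ 1 >
η), (ii) THERMAL GAP OF 4D CFT: inf{c_therm : interacting unitary 4D CFT with stress tensor} > η is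
what a conformal infrared would need to evade, (iii) no generalised-free-field-like infrared for a
local RP lattice theory, (iv) quantitative single-species bound: one boson of mass M has F(M/T) =
0.78, 0.47, 0.26, 0.06 at M/T = 1, 2, 3, 5, so cold-below-T₁ forces every species mass ≥ x(η)T₁
uniformly in k, and transfer-matrix positivity (κ < 1/6) turns the uniform spectral gap into
clustering with pair-wise constan -/
@[route_item "route-QuantumFields-CounterexampleMustBeHot", crux]
def ColdInfraredGap : Prop :=
  open Literature.MathematicalPhysics.QuantumLattice Literature.MathematicalPhysics.QuantumFieldTheory in ∀ Nf : ℕ, Nf = 2 ∨ Nf = 3 → let ρ := fundamentalRep (Fin 3); let St : ℕ → ℕ → Type := fun Nt Ns => ZMod Nt × (Fin 3 → ZMod Ns); let shift : ∀ (Nt Ns : ℕ), St Nt Ns → Option (Fin 3) → St Nt Ns := fun _ _ x μ => Option.elim μ (x.1 + 1, x.2) fun i => (x.1, x.2 + Pi.single i 1); let Cfg : ℕ → ℕ → Type := fun Nt Ns => St Nt Ns × Option (Fin 3) → Matrix.specialUnitaryGroup (Fin 3) ℂ; let plaq : ∀ (Nt Ns : ℕ), Cfg Nt Ns → St Nt Ns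 → Option (Fin 3) → Option (Fin 3) → Matrix.specialUnitaryGroup (Fin 3) ℂ := fun Nt Ns U x μ ν => U (x, μ) * U (shift Nt Ns x μ, ν) * (U (shift Nt Ns x ν, μ))⁻¹ * (U (x, ν))⁻¹; let wt : ∀ (Nt Ns : ℕ) [NeZero Nt] [NeZero Ns], ℝ → Cfg Nt Ns → ℝ := fun Nt Ns _ _ β U => Real.exp (β * ∑ x : St Nt Ns, ∑ i : Fin 3, (ρ (plaq Nt Ns U x none (some i))).trace.re + β * ∑ x : St Nt Ns, ∑ p : {p : Fin 3 × Fin 3 // p.1 < p.2}, (ρ (plaq Nt Ns U x (some p.1.1) (some p.1.2))).trace.re); let μH : ∀ (Nt Ns : ℕ) [NeZero Nt] [NeZero Ns], MeasureTheory.Measure (Cfg Nt Ns) := fun Nt Ns _ _ => MeasureTheory.Measure.pi fun _ : St Nt Ns × Option (Fin 3) => haarProbability (Matrix.specialUnitaryGroup (Fin 3) ℂ); let V : ℕ → ℕ → Type := fun Nt Ns => Fin Nf × (St Nt Ns × Fin 3 × Fin 4); let I : ∀ (Nt Ns : ℕ) [NeZero Nt] [NeZero Ns], Type := fun Nt Ns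 _ _ => Fin (Fintype.card (V Nt Ns)); let D : ∀ (Nt Ns : ℕ) [NeZero Nt] [NeZero Ns], Cfg Nt Ns → (Fin Nf → ℝ) → Matrix (I Nt Ns) (I Nt Ns) ℂ := fun Nt Ns _ _ U mq => let e := Fintype.equivFin (V Nt Ns); Matrix.reindex e e (Matrix.of fun v w : Fin Nf × (St Nt Ns × Fin 3 × Fin 4) => if v.1 = w.1 then ((if v.2 = w.2 then ((mq v.1 + 4 : ℝ) : ℂ) else 0) - 2⁻¹ * ∑ μ : Option (Fin 3), let sgn : St Nt Ns → ℂ := fun x => if μ = none ∧ x.1 = -1 then -1 else 1; ((if w.2.1 = shift Nt Ns v.2.1 μ then sgn v.2.1 * ((1 - euclideanGamma (μ.elim 3 Fin.castSucc)) v.2.2.2 w.2.2.2 * ρ (U (v.2.1, μ)) v.2.2.1 w.2.2.1) else 0) + (if v.2.1 = shift Nt Ns w.2.1 μ then sgn w.2.1 * ((1 + euclideanGamma (μ.elim 3 Fin.castSucc)) v.2.2.2 w.2.2.2 * ρ ((U (w.2.1, μ))⁻¹) v.2.2.1 w.2.2.1) else 0))) else 0); let Z : ∀ (Nt Ns : ℕ)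 [NeZero Nt] [NeZero Ns], ℝ → (Fin Nf → ℝ) → ℂ := fun Nt Ns _ _ β mq => MeasureTheory.integral (μH Nt Ns) fun U => GrassmannAlgebra.berezin ℂ _ (grassmannExp (quadratic ℂ (-D Nt Ns U mq))) * ((wt Nt Ns β U : ℝ) : ℂ); let f : ∀ (Nt Ns : ℕ) [NeZero Nt] [NeZero Ns], ℝ → (Fin Nf → ℝ) → ℝ := fun Nt Ns _ _ β mq => -Real.log ‖Z Nt Ns β mq‖ / ((Nt : ℝ) * (Ns : ℝ) ^ 3); let Lim : QCDScheme Nf → (ℕ → ℕ → ℝ) → (ℕ → ℝ) → Prop := fun sch φ e₀ => (∀ (k Nt : ℕ) [NeZero Nt], Filter.Tendsto (fun Ns : ℕ => f Nt (Ns + 1) (sch.β k) (fun fl => sch.mq fl k)) Filter.atTop (nhds (φ k Nt))) ∧ ∀ k : ℕ, Filter.Tendsto (φ k) Filter.atTop (nhds (e₀ k)); let F : (ℕ → ℕ → ℝ) → (ℕ → ℝ) → ℕ → ℕ → ℝ := fun φ e₀ k Nt => 90 / Real.pi ^ 2 * (Nt : ℝ) ^ 4 * (e₀ k - φ k Nt);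 let Ffin : QCDScheme Nf → (ℕ → ℝ) → ℕ → ∀ (Nt Ns : ℕ) [NeZero Nt] [NeZero Ns], ℝ := fun sch e₀ k Nt Ns _ _ => 90 / Real.pi ^ 2 * (Nt : ℝ) ^ 4 * (e₀ k - f Nt Ns (sch.β k) (fun fl => sch.mq fl k)); let ColdFin : QCDScheme Nf → (ℕ → ℝ) → ℝ → ℝ → Prop := fun sch e₀ η T₁ => ∀ᶠ k in Filter.atTop, ∀ (Nt : ℕ) [NeZero Nt], Nt = ⌈(sch.a k * T₁)⁻¹⌉₊ → ∀ (Ns : ℕ) [NeZero Ns], Nt ≤ Ns → Ffin sch e₀ k Nt Ns ≤ η; let ColdBelow : QCDScheme Nf → (ℕ → ℕ → ℝ) → (ℕ → ℝ) → ℝ → ℝ → Prop := fun sch φ e₀ η T₁ => ∀ᶠ k in Filter.atTop, ∀ N' : ℕ, ⌈(sch.a k * T₁)⁻¹⌉₊ ≤ N' → F φ e₀ k N' ≤ η; ∀ reg : QCDRegularisation Nf, reg.HasMassScaling → (reg.scheme 0 0 0).HasAsymptoticScaling → ∀ m : Fin Nf → ℝ, (∀ fl : Fin Nf, ∀ᶠ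 k in Filter.atTop, -1 < (reg.scheme m 0 0).mq fl k) → ∀ (φ : ℕ → ℕ → ℝ) (e₀ : ℕ → ℝ), Lim (reg.scheme m 0 0) φ e₀ → ∀ η : ℝ, η < 1 → ∀ T₁ : ℝ, 0 < T₁ → ColdFin (reg.scheme m 0 0) e₀ η T₁ → ColdBelow (reg.scheme m 0 0) φ e₀ η T₁ → ∃ Δ : ℝ, 0 < Δ ∧ (reg.scheme m 0 0).HasLatticeMassGap Δ

/-- item stmt-QuantumFields-18044 · crux · rank 5 · open · by planner
why it might fail: k-uniform E0′/tightness bounds for light Wilson quarks (κ→κ_c) exist for no 4D gauge theory (Balaban: pure YM, effective actions); k-uniform calibration-bite/κ₃ LOWER bounds are unproved; chirality must be re-witnessed EVENTUALLY along the extraction (nested violation sets).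
sources: Balaban1988Convergent, OsterwalderSeiler1978, GlimmJaffeQP1987, MontvayMunster1994, SharpeSingleton1998, Literature.Barriers.QuantumFields.UVStabilityNonUniqueness
[crux] (piece 1/3 of the typed decomposition ChiralCalibratedConvergence → ConvergentOSClosure →
RotationRestoration → ChiralContinuumComplement of the RESTATED deciding crux
stmt-QuantumFields-17304 — BC2 redirect, crux-strategist r1 2026-08-17; assembly PROVED sorry-free,
evidence CounterexampleMustBeHotChiralContinuumComplementSplit.lean on 17304, axioms
propext/Classical.choice/Quot.sound; the UV HALF, a ∀-LAW about the GIVEN lattice sequence: no OS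
axiom, no continuum gap, no rotation invariance is asserted) THE CHIRAL SUBSEQUENCE OF THE GIVEN
SEQUENCE CONVERGES AFTER CALIBRATION: for N_f ∈ {2,3} and EVERY mass-independent regularisation reg
carrying the chiral lattice half (leading-log HasMassScaling, reg.IsChiralAtZero, two-loop
asymptotic scaling, and for every positive mass tuple bare masses eventually on the physical branch
and a volume-uniform lattice gap Δ(m) > 0 — verbatim the antecedent of ChiralContinuumComplement)
there are a subsequence φ and a regularisation reg₁ REINDEXED FROM reg ALONG φ — a, β, m_crit, Z_m
are those of reg composed with φ (the thermodynamically certified bare trajectory is kept), volumes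
may only be ENLARGED, L(φ k) ≤ L₁(k) (the periodic seam o -/
@[route_item "route-QuantumFields-CounterexampleMustBeHot"]
def ChiralCalibratedConvergence : Prop :=
  open Literature.MathematicalPhysics.QuantumFieldTheory Literature.MathematicalPhysics.QuantumLattice Literature.MathematicalPhysics.AQFT in ∀ Nf : ℕ, Nf = 2 ∨ Nf = 3 → ∀ reg : QCDRegularisation Nf, reg.HasMassScaling → reg.IsChiralAtZero → (reg.scheme 0 0 0).HasAsymptoticScaling → (∀ m : Fin Nf → ℝ, (∀ f, 0 < m f) → (∀ f, ∀ᶠ k in Filter.atTop, -1 < (reg.scheme m 0 0).mq f k) ∧ ∃ Δ > 0, (reg.scheme m 0 0).HasLatticeMassGap Δ) → ∃ (φ : ℕ → ℕ) (reg₁ : QCDRegularisation Nf), StrictMono φ ∧ reg₁.a = reg.a ∘ φ ∧ reg₁.β = reg.β ∘ φ ∧ reg₁.mcrit = reg.mcrit ∘ φ ∧ reg₁.Zm = reg.Zm ∘ φ ∧ (∀ k, reg.L (φ k) ≤ reg₁.L k) ∧ reg₁.IsChiralAtZero ∧ ∃ 𝒞 : CalibratedSpeciesFamily reg₁, ∀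 m : Fin Nf → ℝ, (∀ f, 0 < m f) → (∀ᶠ k in Filter.atTop, (𝒞.scheme m).twoPoint k QCDField.glue QCDField.glue (thetaTest 4 𝒞.f₀) 𝒞.f₀ = 1) ∧ (∀ f g : Fin Nf, f ≠ g → ∀ᶠ k in Filter.atTop, (𝒞.scheme m).twoPoint k (QCDField.pseudoRe f g) (QCDField.pseudoRe f g) (thetaTest 4 𝒞.f₀) 𝒞.f₀ = 1) ∧ (∃ f g h : SchwartzMap (EuclideanSpace ℝ (Fin 4)) ℝ, tsupport (f : EuclideanSpace ℝ (Fin 4) → ℝ) ⊆ {x | x 0 < 0} ∧ tsupport (g : EuclideanSpace ℝ (Fin 4) → ℝ) ⊆ {x | 0 < x 0 ∧ x 0 < 1} ∧ tsupport (h : EuclideanSpace ℝ (Fin 4) → ℝ) ⊆ {x | 1 < x 0} ∧ ∃ ε > (0 : ℝ), ∀ᶠ k in Filter.atTop, ε ≤ ‖qcdLatticeSchwinger (𝒞.scheme m) k 3 ![QCDField.glue, QCDField.glue, QCDField.glue] ![f, g, h] - qcdLatticeSchwinger (𝒞.scheme m) k 1 ![QCDField.glue] ![f] * qcdLatticeSchwinger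 (𝒞.scheme m) k 2 ![QCDField.glue, QCDField.glue] ![g, h] - qcdLatticeSchwinger (𝒞.scheme m) k 1 ![QCDField.glue] ![g] * qcdLatticeSchwinger (𝒞.scheme m) k 2 ![QCDField.glue, QCDField.glue] ![f, h] - qcdLatticeSchwinger (𝒞.scheme m) k 1 ![QCDField.glue] ![h] * qcdLatticeSchwinger (𝒞.scheme m) k 2 ![QCDField.glue, QCDField.glue] ![f, g] + 2 * (qcdLatticeSchwinger (𝒞.scheme m) k 1 ![QCDField.glue] ![f] * qcdLatticeSchwinger (𝒞.scheme m) k 1 ![QCDField.glue] ![g] * qcdLatticeSchwinger (𝒞.scheme m) k 1 ![QCDField.glue] ![h])‖) ∧ (∀ n : ℕ, n ≠ 0 → ∀ (σ : Fin n → QCDField Nf) (f : Fin n → SchwartzMap (EuclideanSpace ℝ (Fin 4)) ℝ) (F : SchwartzMap (Fin n → EuclideanSpace ℝ (Fin 4)) ℂ), IsTensorOf F (fun i => ofRealTest (f i)) → IsOffDiagonal F → ∃ c : ℂ, Filter.Tendsto (fun k : ℕ => qcdLatticeSchwinger (𝒞.scheme m) k n σ f) Filter.atTop (nhds c))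

/-- item stmt-QuantumFields-18760 · crux · rank 6 · open · by planner
why it might fail: A uniform gap bounds the time-decay of fixed observables, not the density of states: a near-flat band or extensive near-gap degeneracy saturating ε along the sequence gives F ~ N_t³e^{−ε/T} → ∞; c uniform in m needs a bounded species count over all tuples; no low-T expansion beyond strong coupling.
sources: AppelquistCohenSchmaltz1999, GerberLeutwyler1989, Luscher1977, Luscher1986, OsterwalderSeiler1978, MontvayMunster1994
[crux] (piece 3/3 of the typed decomposition ColdHotWitness → FreeEnergyLimits → GapImpliesCold →
ChiralColdCertificate of stmt-QuantumFields-17303, glue ChiralColdCertificateOfSplit; universal —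
the EASY direction ‘gapped ⇒ cold’ of the route's gap ⟺ cold dictionary made a lattice lemma; the
hard direction ‘cold ⇒ gapped’ is ColdInfraredGap) for N_f = 2, 3, every regularisation reg with
mass scaling and two-loop asymptotic scaling and every coldness level θ > 0 there is c = c(reg, θ) >
0 such that for EVERY positive mass tuple m (bare masses eventually on the physical branch) and
every ε > 0: IF the lattice theory along reg.scheme m has the volume-uniform full-spectrum gap
`HasLatticeMassGap ε`, THEN, whenever the thermodynamic limits φ, e₀ exist, at every temperature 0 <
T ≤ c·ε the infinite-volume d.o.f. count is eventually θ-cold: ∀ᶠ k, F_k(⌈1/(a_k T)⌉) =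
(90/π²)N_t⁴(e₀(k) − φ_k(N_t)) ≤ θ. Physics: a theory whose lightest excitation has mass M ≥ ε is a
dilute massive gas at T ≪ M, p/T⁴ = g (M/2πT)^{3/2} e^{−M/T}(1 + …) (one boson: F = 0.78, 0.47,
0.26, 0.06 at M/T = 1, 2, 3, 5), so F ≤ θ once M/T ≥ x(θ, g); c uniform in m asks the number g of
near-gap species (3 or 8 pseudo-Gol -/
@[route_item "route-QuantumFields-CounterexampleMustBeHot", crux]
def GapImpliesCold : Prop :=
  open Literature.MathematicalPhysics.QuantumLattice Literature.MathematicalPhysics.QuantumFieldTheory in ∀ Nf : ℕ, Nf = 2 ∨ Nf = 3 → let ρ := fundamentalRep (Fin 3); let St : ℕ → ℕ → Type := fun Nt Ns => ZMod Nt × (Fin 3 → ZMod Ns); let shift : ∀ (Nt Ns : ℕ), St Nt Ns → Option (Fin 3) → St Nt Ns := fun _ _ x μ => Option.elim μ (x.1 + 1, x.2) fun i => (x.1, x.2 + Pi.single i 1); let Cfg : ℕ → ℕ → Type := fun Nt Ns => St Nt Ns × Option (Fin 3) → Matrix.specialUnitaryGroup (Fin 3) ℂ; let plaq : ∀ (Nt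 Ns : ℕ), Cfg Nt Ns → St Nt Ns → Option (Fin 3) → Option (Fin 3) → Matrix.specialUnitaryGroup (Fin 3) ℂ := fun Nt Ns U x μ ν => U (x, μ) * U (shift Nt Ns x μ, ν) * (U (shift Nt Ns x ν, μ))⁻¹ * (U (x, ν))⁻¹; let wt : ∀ (Nt Ns : ℕ) [NeZero Nt] [NeZero Ns], ℝ → Cfg Nt Ns → ℝ := fun Nt Ns _ _ β U => Real.exp (β * ∑ x : St Nt Ns, ∑ i : Fin 3, (ρ (plaq Nt Ns U x none (some i))).trace.re + β * ∑ x : St Nt Ns, ∑ p : {p : Fin 3 × Fin 3 // p.1 < p.2}, (ρ (plaq Nt Ns U x (some p.1.1) (some p.1.2))).trace.re); let μH : ∀ (Nt Ns : ℕ) [NeZero Nt] [NeZero Ns], MeasureTheory.Measure (Cfg Nt Ns) := fun Nt Ns _ _ => MeasureTheory.Measure.pi fun _ : St Nt Ns × Option (Fin 3) => haarProbability (Matrix.specialUnitaryGroup (Fin 3) ℂ); let V : ℕ → ℕ → Type := fun Nt Ns => Fin Nf × (St Nt Ns × Fin 3 × Fin 4); let I : ∀ (Nt Ns : ℕ) [NeZero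 Nt] [NeZero Ns], Type := fun Nt Ns _ _ => Fin (Fintype.card (V Nt Ns)); let D : ∀ (Nt Ns : ℕ) [NeZero Nt] [NeZero Ns], Cfg Nt Ns → (Fin Nf → ℝ) → Matrix (I Nt Ns) (I Nt Ns) ℂ := fun Nt Ns _ _ U mq => let e := Fintype.equivFin (V Nt Ns); Matrix.reindex e e (Matrix.of fun v w : Fin Nf × (St Nt Ns × Fin 3 × Fin 4) => if v.1 = w.1 then ((if v.2 = w.2 then ((mq v.1 + 4 : ℝ) : ℂ) else 0) - 2⁻¹ * ∑ μ : Option (Fin 3), let sgn : St Nt Ns → ℂ := fun x => if μ = none ∧ x.1 = -1 then -1 else 1; ((if w.2.1 = shift Nt Ns v.2.1 μ then sgn v.2.1 * ((1 - euclideanGamma (μ.elim 3 Fin.castSucc)) v.2.2.2 w.2.2.2 * ρ (U (v.2.1, μ)) v.2.2.1 w.2.2.1) else 0) + (if v.2.1 = shift Nt Ns w.2.1 μ then sgn w.2.1 * ((1 + euclideanGamma (μ.elim 3 Fin.castSucc)) v.2.2.2 w.2.2.2 * ρ ((U (w.2.1, μ))⁻¹) v.2.2.1 w.2.2.1) else 0)))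 else 0); let Z : ∀ (Nt Ns : ℕ) [NeZero Nt] [NeZero Ns], ℝ → (Fin Nf → ℝ) → ℂ := fun Nt Ns _ _ β mq => MeasureTheory.integral (μH Nt Ns) fun U => GrassmannAlgebra.berezin ℂ _ (grassmannExp (quadratic ℂ (-D Nt Ns U mq))) * ((wt Nt Ns β U : ℝ) : ℂ); let f : ∀ (Nt Ns : ℕ) [NeZero Nt] [NeZero Ns], ℝ → (Fin Nf → ℝ) → ℝ := fun Nt Ns _ _ β mq => -Real.log ‖Z Nt Ns β mq‖ / ((Nt : ℝ) * (Ns : ℝ) ^ 3); let Lim : QCDScheme Nf → (ℕ → ℕ → ℝ) → (ℕ → ℝ) → Prop := fun sch φ e₀ => (∀ (k Nt : ℕ) [NeZero Nt], Filter.Tendsto (fun Ns : ℕ => f Nt (Ns + 1) (sch.β k) (fun fl => sch.mq fl k)) Filter.atTop (nhds (φ k Nt))) ∧ ∀ k : ℕ, Filter.Tendsto (φ k) Filter.atTop (nhds (e₀ k)); let F : (ℕ → ℕ → ℝ) → (ℕ → ℝ) → ℕ → ℕ → ℝ := fun φ e₀ k Nt => 90 / Real.pi ^ 2 * (Nt :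 ℝ) ^ 4 * (e₀ k - φ k Nt); ∀ reg : QCDRegularisation Nf, reg.HasMassScaling → (reg.scheme 0 0 0).HasAsymptoticScaling → ∀ θ : ℝ, 0 < θ → ∃ c : ℝ, 0 < c ∧ ∀ m : Fin Nf → ℝ, (∀ fl, 0 < m fl) → (∀ fl : Fin Nf, ∀ᶠ k in Filter.atTop, -1 < (reg.scheme m 0 0).mq fl k) → ∀ ε : ℝ, 0 < ε → (reg.scheme m 0 0).HasLatticeMassGap ε → ∀ (φ : ℕ → ℕ → ℝ) (e₀ : ℕ → ℝ), Lim (reg.scheme m 0 0) φ e₀ → ∀ T : ℝ, 0 < T → T ≤ c * ε → ∀ᶠ k in Filter.atTop, F φ e₀ k ⌈((reg.scheme m 0 0).a k * T)⁻¹⌉₊ ≤ θ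

/-- item stmt-QuantumFields-18759 · crux · rank 7 · open · by planner
why it might fail: For 1/8 ≤ κ_f < 1/6 (light quarks) the hopping expansion diverges and det D_W(U) is sign-indefinite flavour by flavour: no subadditivity of log‖Z‖ in N_s (Z > 0 only through the TIME transfer matrix; spatially it is a supertrace); no proof of the pressure limit exists there. N_t = 1 is included.
sources: Luscher1977, Ruelle1969, Simon1993, OsterwalderSeiler1978, MontvayMunster1994, BorgsSeiler1983
[crux] (piece 2/3 of the typed decomposition ColdHotWitness → FreeEnergyLimits → GapImpliesCold →
ChiralColdCertificate of stmt-QuantumFields-17303, glue ChiralColdCertificateOfSplit; universal; the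
‘existence of the thermodynamic limits’ the route header listed under NOT DECOMPOSED YET) for N_f =
2, 3 and EVERY lattice QCD scheme sch with bare couplings β_k ≥ 0 and all bare Wilson masses on the
Lüscher-positive branch m_f(k) > −1 at every k (|κ| < 1/6, r = 1: Z_AP = Tr 𝒯^{N_t} > 0, Lüscher
1977, Montvay–Münster (4.111)), the thermal free energy per site f_k(N_t,N_s) = −log‖Z_AP(N_t,N_s;
β_k, m(k))‖/(N_t N_s³) of Wilson SU(3) + N_f time-antiperiodic Wilson quarks on ℤ_{N_t} × ℤ_{N_s}³
has, for every k and every N_t ≥ 1, a spatial thermodynamic limit φ_k(N_t) = lim_{N_s} f_k(N_t,N_s),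
and φ_k(N_t) → e₀(k) (vacuum energy per site) as N_t → ∞ — limit functions φ, e₀ with `Lim sch φ e₀`
exist (pointwise in k, nothing uniform). Provable now for κ_f < 1/8 (all bare masses > 0): the
hopping expansion log det(1 − κM(U)) = −Σ_n κⁿ tr Mⁿ/n converges absolutely and uniformly in U (‖M‖
≤ 8), the Wilson determinant is positive (γ₅-hermiticity makes every tr Mⁿ real), so Z is the
partition funct -/
@[route_item "route-QuantumFields-CounterexampleMustBeHot", crux]
def FreeEnergyLimits : Prop :=
  open Literature.MathematicalPhysics.QuantumLattice Literature.MathematicalPhysics.QuantumFieldTheory in ∀ Nf : ℕ, Nf = 2 ∨ Nf = 3 → let ρ := fundamentalRep (Fin 3); let St : ℕ → ℕ → Type := fun Nt Ns => ZMod Nt × (Fin 3 → ZMod Ns); let shift : ∀ (Nt Ns : ℕ), St Nt Ns → Option (Fin 3) → St Nt Ns := fun _ _ x μ => Option.elim μ (x.1 + 1, x.2) fun i => (x.1, x.2 + Pi.single i 1); let Cfg : ℕ → ℕ → Type := fun Nt Ns => St Nt Ns × Option (Fin 3) → Matrix.specialUnitaryGroup (Fin 3) ℂ; let plaq : ∀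 (Nt Ns : ℕ), Cfg Nt Ns → St Nt Ns → Option (Fin 3) → Option (Fin 3) → Matrix.specialUnitaryGroup (Fin 3) ℂ := fun Nt Ns U x μ ν => U (x, μ) * U (shift Nt Ns x μ, ν) * (U (shift Nt Ns x ν, μ))⁻¹ * (U (x, ν))⁻¹; let wt : ∀ (Nt Ns : ℕ) [NeZero Nt] [NeZero Ns], ℝ → Cfg Nt Ns → ℝ := fun Nt Ns _ _ β U => Real.exp (β * ∑ x : St Nt Ns, ∑ i : Fin 3, (ρ (plaq Nt Ns U x none (some i))).trace.re + β * ∑ x : St Nt Ns, ∑ p : {p : Fin 3 × Fin 3 // p.1 < p.2}, (ρ (plaq Nt Ns U x (some p.1.1) (some p.1.2))).trace.re); let μH : ∀ (Nt Ns : ℕ) [NeZero Nt] [NeZero Ns], MeasureTheory.Measure (Cfg Nt Ns) := fun Nt Ns _ _ => MeasureTheory.Measure.pi fun _ : St Nt Ns × Option (Fin 3) => haarProbability (Matrix.specialUnitaryGroup (Fin 3) ℂ); let V : ℕ → ℕ → Type := fun Nt Ns => Fin Nf × (St Nt Ns × Fin 3 × Fin 4); let I : ∀ (Nt Ns : ℕ)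 [NeZero Nt] [NeZero Ns], Type := fun Nt Ns _ _ => Fin (Fintype.card (V Nt Ns)); let D : ∀ (Nt Ns : ℕ) [NeZero Nt] [NeZero Ns], Cfg Nt Ns → (Fin Nf → ℝ) → Matrix (I Nt Ns) (I Nt Ns) ℂ := fun Nt Ns _ _ U mq => let e := Fintype.equivFin (V Nt Ns); Matrix.reindex e e (Matrix.of fun v w : Fin Nf × (St Nt Ns × Fin 3 × Fin 4) => if v.1 = w.1 then ((if v.2 = w.2 then ((mq v.1 + 4 : ℝ) : ℂ) else 0) - 2⁻¹ * ∑ μ : Option (Fin 3), let sgn : St Nt Ns → ℂ := fun x => if μ = none ∧ x.1 = -1 then -1 else 1; ((if w.2.1 = shift Nt Ns v.2.1 μ then sgn v.2.1 * ((1 - euclideanGamma (μ.elim 3 Fin.castSucc)) v.2.2.2 w.2.2.2 * ρ (U (v.2.1, μ)) v.2.2.1 w.2.2.1) else 0) + (if v.2.1 = shift Nt Ns w.2.1 μ then sgn w.2.1 * ((1 + euclideanGamma (μ.elim 3 Fin.castSucc)) v.2.2.2 w.2.2.2 * ρ ((U (w.2.1, μ))⁻¹) v.2.2.1 w.2.2.1)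 else 0))) else 0); let Z : ∀ (Nt Ns : ℕ) [NeZero Nt] [NeZero Ns], ℝ → (Fin Nf → ℝ) → ℂ := fun Nt Ns _ _ β mq => MeasureTheory.integral (μH Nt Ns) fun U => GrassmannAlgebra.berezin ℂ _ (grassmannExp (quadratic ℂ (-D Nt Ns U mq))) * ((wt Nt Ns β U : ℝ) : ℂ); let f : ∀ (Nt Ns : ℕ) [NeZero Nt] [NeZero Ns], ℝ → (Fin Nf → ℝ) → ℝ := fun Nt Ns _ _ β mq => -Real.log ‖Z Nt Ns β mq‖ / ((Nt : ℝ) * (Ns : ℝ) ^ 3); let Lim : QCDScheme Nf → (ℕ → ℕ → ℝ) → (ℕ → ℝ) → Prop := fun sch φ e₀ => (∀ (k Nt : ℕ) [NeZero Nt], Filter.Tendsto (fun Ns : ℕ => f Nt (Ns + 1) (sch.β k) (fun fl => sch.mq fl k)) Filter.atTop (nhds (φ k Nt))) ∧ ∀ k : ℕ, Filter.Tendsto (φ k) Filter.atTop (nhds (e₀ k)); ∀ sch : QCDScheme Nf, (∀ k : ℕ, 0 ≤ sch.β k) → (∀ (fl : Fin Nf) (k : ℕ), -1 < sch.mq fl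 k) → ∃ (φ : ℕ → ℕ → ℝ) (e₀ : ℕ → ℝ), Lim sch φ e₀

/-- item stmt-QuantumFields-17303 · support · rank 3 · open · by planner
why it might fail: Derived node: implied by ColdHotWitness ∧ FreeEnergyLimits ∧ GapImpliesCold (glue ChiralColdCertificateOfSplit, stmt-QuantumFields-18920, proved); fails iff a piece fails — COLD/HOT certificate (18758), thermodynamic limits (18759), gap ⇒ cold (18760).
sources: Balaban1988Convergent, Literature.Barriers.QuantumFields.UVStabilityNonUniqueness, OsterwalderSeiler1978, Luscher1977, Luscher1986, MontvayMunster1994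
[crux] (card K2 + the re-typed conjunct's chirality clause, p117723; ∃-form exactly like QCDOf;
supersedes ColdCertificate stmt-QuantumFields-10192 on this route) for N_f = 2 and N_f = 3 there is
ONE mass-independent regularisation reg with HasMassScaling and two-loop HasAsymptoticScaling which
is CHIRAL AT ZERO — reg.IsChiralAtZero: for every ε > 0 some positive mass tuple has no uniform
lattice gap ε, i.e. the lattice gap closes as m → 0⁺ (Goldstone pions), which pins the flavour-blind
additive offset of m_crit to the chiral point — such that for EVERY positive mass tuple m (no
threshold M₀ any more: the shift m_crit ↦ m_crit + a_k M₀/Z_m that absorbed it is exactly what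
chirality forbids, Negative.ChiralityObstruction.not_isChiralAtZero_mcrit_shift_of_uniformGapAbove):
the bare masses stay on the physical branch m_f(k) > −1; the spatial thermodynamic limits φ_k(N_t)
of the thermal free energy per site and the zero-temperature limits e₀(k) exist (`Lim`); and there
are η < 1 and a temperature T₁ > 0 depending on m (T₁(m) → 0 in the chiral regime, T₁ ≲ m_π/4 with
m_π² ∝ m) such that eventually in k, at the single temporal extent N₁(k) = ⌈1/(a_k T₁)⌉ and for
EVERY spatial size N_s ≥ -/
@[route_item "route-QuantumFields-CounterexampleMustBeHot"]
def ChiralColdCertificate : Prop :=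
  open Literature.MathematicalPhysics.QuantumLattice Literature.MathematicalPhysics.QuantumFieldTheory in ∀ Nf : ℕ, Nf = 2 ∨ Nf = 3 → let ρ := fundamentalRep (Fin 3); let St : ℕ → ℕ → Type := fun Nt Ns => ZMod Nt × (Fin 3 → ZMod Ns); let shift : ∀ (Nt Ns : ℕ), St Nt Ns → Option (Fin 3) → St Nt Ns := fun _ _ x μ => Option.elim μ (x.1 + 1, x.2) fun i => (x.1, x.2 + Pi.single i 1); let Cfg : ℕ → ℕ → Type := fun Nt Ns => St Nt Ns × Option (Fin 3) → Matrix.specialUnitaryGroup (Fin 3) ℂ; let plaq : ∀ (Nt Ns : ℕ), Cfg Nt Ns → St Nt Ns → Option (Fin 3) → Option (Fin 3) → Matrix.specialUnitaryGroup (Fin 3) ℂ := fun Nt Ns U x μ ν => U (x, μ) * U (shift Nt Ns x μ, ν) * (U (shift Nt Ns x ν, μ))⁻¹ * (U (x, ν))⁻¹; let wt : ∀ (Nt Ns : ℕ) [NeZero Nt] [NeZero Ns], ℝ → Cfg Nt Ns → ℝ := fun Nt Ns _ _ β U => Real.exp (β * ∑ x : St Nt Ns, ∑ i : Fin 3, (ρ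 (plaq Nt Ns U x none (some i))).trace.re + β * ∑ x : St Nt Ns, ∑ p : {p : Fin 3 × Fin 3 // p.1 < p.2}, (ρ (plaq Nt Ns U x (some p.1.1) (some p.1.2))).trace.re); let μH : ∀ (Nt Ns : ℕ) [NeZero Nt] [NeZero Ns], MeasureTheory.Measure (Cfg Nt Ns) := fun Nt Ns _ _ => MeasureTheory.Measure.pi fun _ : St Nt Ns × Option (Fin 3) => haarProbability (Matrix.specialUnitaryGroup (Fin 3) ℂ); let V : ℕ → ℕ → Type := fun Nt Ns => Fin Nf × (St Nt Ns × Fin 3 × Fin 4); let I : ∀ (Nt Ns : ℕ) [NeZero Nt] [NeZero Ns], Type := fun Nt Ns _ _ => Fin (Fintype.card (V Nt Ns)); let D : ∀ (Nt Ns : ℕ) [NeZero Nt] [NeZero Ns], Cfg Nt Ns → (Fin Nf → ℝ) → Matrix (I Nt Ns) (I Nt Ns) ℂ := fun Nt Ns _ _ U mq => let e := Fintype.equivFin (V Nt Ns); Matrix.reindex e e (Matrix.of fun v w : Fin Nf × (St Nt Ns × Fin 3 × Fin 4) => if v.1 = w.1 then ((if v.2 = w.2 then ((mq v.1 + 4 :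 ℝ) : ℂ) else 0) - 2⁻¹ * ∑ μ : Option (Fin 3), let sgn : St Nt Ns → ℂ := fun x => if μ = none ∧ x.1 = -1 then -1 else 1; ((if w.2.1 = shift Nt Ns v.2.1 μ then sgn v.2.1 * ((1 - euclideanGamma (μ.elim 3 Fin.castSucc)) v.2.2.2 w.2.2.2 * ρ (U (v.2.1, μ)) v.2.2.1 w.2.2.1) else 0) + (if v.2.1 = shift Nt Ns w.2.1 μ then sgn w.2.1 * ((1 + euclideanGamma (μ.elim 3 Fin.castSucc)) v.2.2.2 w.2.2.2 * ρ ((U (w.2.1, μ))⁻¹) v.2.2.1 w.2.2.1) else 0))) else 0); let Z : ∀ (Nt Ns : ℕ) [NeZero Nt] [NeZero Ns], ℝ → (Fin Nf → ℝ) → ℂ := fun Nt Ns _ _ β mq => MeasureTheory.integral (μH Nt Ns) fun U => GrassmannAlgebra.berezin ℂ _ (grassmannExp (quadratic ℂ (-D Nt Ns U mq))) * ((wt Nt Ns β U : ℝ) : ℂ); let f : ∀ (Nt Ns : ℕ) [NeZero Nt] [NeZero Ns], ℝ → (Fin Nf → ℝ) → ℝ := fun Nt Ns _ _ β mq => -Real.log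 ‖Z Nt Ns β mq‖ / ((Nt : ℝ) * (Ns : ℝ) ^ 3); let Lim : QCDScheme Nf → (ℕ → ℕ → ℝ) → (ℕ → ℝ) → Prop := fun sch φ e₀ => (∀ (k Nt : ℕ) [NeZero Nt], Filter.Tendsto (fun Ns : ℕ => f Nt (Ns + 1) (sch.β k) (fun fl => sch.mq fl k)) Filter.atTop (nhds (φ k Nt))) ∧ ∀ k : ℕ, Filter.Tendsto (φ k) Filter.atTop (nhds (e₀ k)); let Ffin : QCDScheme Nf → (ℕ → ℝ) → ℕ → ∀ (Nt Ns : ℕ) [NeZero Nt] [NeZero Ns], ℝ := fun sch e₀ k Nt Ns _ _ => 90 / Real.pi ^ 2 * (Nt : ℝ) ^ 4 * (e₀ k - f Nt Ns (sch.β k) (fun fl => sch.mq fl k)); let ColdFin : QCDScheme Nf → (ℕ → ℝ) → ℝ → ℝ → Prop := fun sch e₀ η T₁ => ∀ᶠ k in Filter.atTop, ∀ (Nt : ℕ) [NeZero Nt], Nt = ⌈(sch.a k * T₁)⁻¹⌉₊ → ∀ (Ns : ℕ) [NeZero Ns], Nt ≤ Ns → Ffin sch e₀ k Nt Ns ≤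 η; ∃ reg : QCDRegularisation Nf, reg.HasMassScaling ∧ reg.IsChiralAtZero ∧ (reg.scheme 0 0 0).HasAsymptoticScaling ∧ ∀ m : Fin Nf → ℝ, (∀ fl, 0 < m fl) → (∀ fl : Fin Nf, ∀ᶠ k in Filter.atTop, -1 < (reg.scheme m 0 0).mq fl k) ∧ ∃ (φ : ℕ → ℕ → ℝ) (e₀ : ℕ → ℝ), Lim (reg.scheme m 0 0) φ e₀ ∧ ∃ η : ℝ, η < 1 ∧ ∃ T₁ : ℝ, 0 < T₁ ∧ ColdFin (reg.scheme m 0 0) e₀ η T₁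

/-- item stmt-QuantumFields-17304 · support · rank 5 · open · by planner
why it might fail: Derived node: implied by ChiralCalibratedConvergence ∧ ConvergentOSClosure ∧ RotationRestoration (skeleton Lines/pieces.lean, glue ChiralContinuumComplement_of PROVED; items 18044/11525/8840); fails iff a piece fails — UV convergence along the chiral subsequence, OS closure, or E1.
sources: JaffeWitten2000, OsterwalderSeiler1978, Balaban1988Convergent, MontvayMunster1994, Literature.Barriers.QuantumFields.RegularisationDichotomy, Literature.Barriers.QuantumFields.UVStabilityNonUniqueness
[crux] (UV/OS complement RE-TYPED for the chiral conjunct, p117723; supersedes the shared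
ContinuumComplement stmt-QuantumFields-9643 on this route; lowest on the chain) THE CHIRAL LATTICE
HALF implies the conjunct: if for N_f = 2 and 3 one mass-independent regularisation with leading-log
mass scaling and two-loop asymptotic scaling is chiral at zero (reg.IsChiralAtZero) and has, for
EVERY positive mass tuple, bare masses on the physical branch and a volume-uniform full-spectrum
lattice gap HasLatticeMassGap Δ(m), then QCD: along that regularisation — or a CHIRALITY-PRESERVING
diagonal subsequence (¬HasLatticeMassGap ε is `∃ A B, ∀ C, frequently in k`, so the subsequence must
keep infinitely many violating k for each (ε_j = 1/j, C = j): countable bookkeeping; mass scaling,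
asymptotic scaling, branch and gap clauses pass to subsequences for free) — the smeared glue /
pseudoscalar lattice Schwinger functions converge, with calibrated species renormalisations z,
shift, to OS data (E0′, E1 with rotations restored, E2–E4) that are IsQCDAlong, non-trivial and
non-Gaussian in glue, have dynamical quarks (flavour-changing pseudoscalars non-trivial) and inherit
the gap (T.HasMassGap Δ′ with -/
@[route_item "route-QuantumFields-CounterexampleMustBeHot", crux]
def ChiralContinuumComplement : Prop :=
  (∀ Nf : ℕ, Nf = 2 ∨ Nf = 3 → ∃ reg : Literature.MathematicalPhysics.QuantumFieldTheory.QCDRegularisation Nf, reg.HasMassScaling ∧ reg.IsChiralAtZero ∧ (reg.scheme 0 0 0).HasAsymptoticScaling ∧ ∀ m : Fin Nf → ℝ, (∀ f, 0 < m f) → (∀ f, ∀ᶠ k in Filter.atTop, -1 < (reg.scheme m 0 0).mq f k) ∧ ∃ Δ > 0, (reg.scheme m 0 0).HasLatticeMassGap Δ) → QCD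

/-- item stmt-QuantumFields-10194 · support · rank 9 · open · by planner
sources: OsterwalderSeiler1978, Seiler1982, MontvayMunster1994, doi:10.1016/0550-3213(96)00170-8
[support] (card P2, the solvable corner; calibration for provers and refuters, off the assembly
chain) for N_f ∈ {2,3} there are β₀ > 0 and a bare-mass threshold M (heavy quarks, small hopping
parameter) such that for all 0 < β ≤ β₀ and all m_f ≥ M: the spatial thermodynamic limits φ(N_t) of
the thermal free energy per site and e₀ = lim φ exist, Θ⁺ holds on the whole range N_t ≥ 2 (N ≤ N' ⇒
N'⁴(e₀ − φ(N')) ≤ N⁴(e₀ − φ(N))), and N_t⁴(e₀ − φ(N_t)) → 0 (cold): the Osterwalder–Seiler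
strong-coupling/hopping cluster expansion re-derived thermodynamically, thermal corrections being
sums over polymers winding the time circle (gluon tubes u(β)^{4N_t}, quark loops κ^{N_t}) with
positive character coefficients; the card's kit toys (free lattice scalar and r = 1 Wilson fermion
monotone for N_t ≥ 2, violated at N_t = 1; SU(3) leading strong-coupling term monotone for u ≤
e^{−3/4}) are its zeroth order. [difficulty: L] -/
@[route_item "route-QuantumFields-CounterexampleMustBeHot"]
def StrongCouplingAnchor : Prop :=
  open Literature.MathematicalPhysics.QuantumLattice Literature.MathematicalPhysics.QuantumFieldTheory in ∀ Nf : ℕ, Nf = 2 ∨ Nf = 3 → let ρ := fundamentalRep (Fin 3); let St : ℕ → ℕ → Type := fun Nt Ns => ZMod Nt × (Fin 3 → ZMod Ns); let shift : ∀ (Nt Ns : ℕ), St Nt Ns → Option (Fin 3) → St Nt Ns := fun _ _ x μ => Option.elim μ (x.1 + 1, x.2) fun i => (x.1, x.2 + Pi.single i 1); let Cfg : ℕ → ℕ → Type := fun Nt Ns => St Nt Ns × Option (Fin 3) → Matrix.specialUnitaryGroup (Fin 3) ℂ; let plaq : ∀ (Nt Ns : ℕ), Cfg Nt Ns → St Nt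 Ns → Option (Fin 3) → Option (Fin 3) → Matrix.specialUnitaryGroup (Fin 3) ℂ := fun Nt Ns U x μ ν => U (x, μ) * U (shift Nt Ns x μ, ν) * (U (shift Nt Ns x ν, μ))⁻¹ * (U (x, ν))⁻¹; let wt : ∀ (Nt Ns : ℕ) [NeZero Nt] [NeZero Ns], ℝ → Cfg Nt Ns → ℝ := fun Nt Ns _ _ β U => Real.exp (β * ∑ x : St Nt Ns, ∑ i : Fin 3, (ρ (plaq Nt Ns U x none (some i))).trace.re + β * ∑ x : St Nt Ns, ∑ p : {p : Fin 3 × Fin 3 // p.1 < p.2}, (ρ (plaq Nt Ns U x (some p.1.1) (some p.1.2))).trace.re); let μH : ∀ (Nt Ns : ℕ) [NeZero Nt] [NeZero Ns], MeasureTheory.Measure (Cfg Nt Ns) := fun Nt Ns _ _ => MeasureTheory.Measure.pi fun _ : St Nt Ns × Option (Fin 3) => haarProbability (Matrix.specialUnitaryGroup (Fin 3) ℂ); let V : ℕ → ℕ → Type := fun Nt Ns => Fin Nf × (St Nt Ns × Fin 3 × Fin 4); let I : ∀ (Nt Ns : ℕ) [NeZero Nt] [NeZero Ns], Type := fun Nt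 Ns _ _ => Fin (Fintype.card (V Nt Ns)); let D : ∀ (Nt Ns : ℕ) [NeZero Nt] [NeZero Ns], Cfg Nt Ns → (Fin Nf → ℝ) → Matrix (I Nt Ns) (I Nt Ns) ℂ := fun Nt Ns _ _ U mq => let e := Fintype.equivFin (V Nt Ns); Matrix.reindex e e (Matrix.of fun v w : Fin Nf × (St Nt Ns × Fin 3 × Fin 4) => if v.1 = w.1 then ((if v.2 = w.2 then ((mq v.1 + 4 : ℝ) : ℂ) else 0) - 2⁻¹ * ∑ μ : Option (Fin 3), let sgn : St Nt Ns → ℂ := fun x => if μ = none ∧ x.1 = -1 then -1 else 1; ((if w.2.1 = shift Nt Ns v.2.1 μ then sgn v.2.1 * ((1 - euclideanGamma (μ.elim 3 Fin.castSucc)) v.2.2.2 w.2.2.2 * ρ (U (v.2.1, μ)) v.2.2.1 w.2.2.1) else 0) + (if v.2.1 = shift Nt Ns w.2.1 μ then sgn w.2.1 * ((1 + euclideanGamma (μ.elim 3 Fin.castSucc)) v.2.2.2 w.2.2.2 * ρ ((U (w.2.1, μ))⁻¹) v.2.2.1 w.2.2.1) else 0))) else 0); let Z : ∀ (Nt Ns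 : ℕ) [NeZero Nt] [NeZero Ns], ℝ → (Fin Nf → ℝ) → ℂ := fun Nt Ns _ _ β mq => MeasureTheory.integral (μH Nt Ns) fun U => GrassmannAlgebra.berezin ℂ _ (grassmannExp (quadratic ℂ (-D Nt Ns U mq))) * ((wt Nt Ns β U : ℝ) : ℂ); let f : ∀ (Nt Ns : ℕ) [NeZero Nt] [NeZero Ns], ℝ → (Fin Nf → ℝ) → ℝ := fun Nt Ns _ _ β mq => -Real.log ‖Z Nt Ns β mq‖ / ((Nt : ℝ) * (Ns : ℝ) ^ 3); ∃ β₀ : ℝ, 0 < β₀ ∧ ∃ M : ℝ, 0 < M ∧ ∀ β : ℝ, 0 < β → β ≤ β₀ → ∀ mq : Fin Nf → ℝ, (∀ fl, M ≤ mq fl) → ∃ (φ : ℕ → ℝ) (e₀ : ℝ), (∀ (Nt : ℕ) [NeZero Nt], Filter.Tendsto (fun Ns : ℕ => f Nt (Ns + 1) β mq) Filter.atTop (nhds (φ Nt))) ∧ Filter.Tendsto φ Filter.atTop (nhds e₀) ∧ (∀ N N' : ℕ, 2 ≤ N → N ≤ N' → (N' : ℝ) ^ 4 * (e₀ - φ N')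 ≤ (N : ℝ) ^ 4 * (e₀ - φ N)) ∧ Filter.Tendsto (fun Nt : ℕ => (Nt : ℝ) ^ 4 * (e₀ - φ Nt)) Filter.atTop (nhds 0)

/-- item stmt-QuantumFields-11525 · support · rank 9 · open · by planner
why it might fail: Pointwise limits on off-diagonal tensors give neither E0' (k-uniform Schwartz bounds = fermionic UV stability in ratio form, hypothesis of GJ Thm 17.9.1) nor S.HasMassGap at the lattice Δ (HasLatticeMassGap bounds FIXED observable pairs, not k-dependent renormalised fields); RP needs S→∞ before k→∞.
sources: OsterwalderSchrader1975, GlimmJaffeQP1987, OsterwalderSeilerAnnPhys1978, Luscher1977, SeilerLNP1982, MontvayMunster1994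
[crux] OS CLOSURE OF A CONVERGENT CALIBRATED FAMILY, MODULO ROTATIONS (card P3 made a crux;
conclusion shaped as the per-(reg, m) matrix of FourMirrorsWardE1.QCDModuloRotations,
stmt-QuantumFields-8842). For every N_f, regularisation reg, calibrated family 𝒞 and positive mass
tuple m: IF 𝒞.scheme m scales asymptotically with bare masses eventually on the physical branch, has
a uniform lattice gap, the calibration bites eventually for `glue` and the flavour-changing
`pseudoRe f g`, the glue κ₃-witness holds, and EVERY calibrated lattice n-point function converges
(full sequence) on off-diagonal tensors, THEN there is a labelled Schwinger family S which is
normalised, hermitian, of linear growth (E0'), translation invariant, reflection positive,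
symmetric, clustering, IS that limit on off-diagonal tensors, has a species mass gap `S.HasMassGap
Δ` together with the lattice gap at the same Δ > 0, and — once S is invariant under proper rotations
on ⁰𝒮 — packages into OS data T with T.schwinger = S, `IsNontrivial glue`, `IsNonGaussian glue` and
`IsNontrivial (pseudoRe f g)` for all f ≠ g (the last three from the calibration and κ₃ clauses by
the provable-now witness lemmas TwoPointWitness -/
@[route_item "route-QuantumFields-CounterexampleMustBeHot"]
def ConvergentOSClosure : Prop :=
  open Literature.MathematicalPhysics.QuantumFieldTheory Literature.MathematicalPhysics.QuantumLattice Literature.MathematicalPhysics.AQFT in ∀ (Nf : ℕ) (reg : QCDRegularisation Nf) (𝒞 : CalibratedSpeciesFamily reg) (m : Fin Nf → ℝ), (∀ f, 0 < m f) → (𝒞.scheme m).HasAsymptoticScaling → (∀ fl : Fin Nf, ∀ᶠ k in Filter.atTop, -1 < (𝒞.scheme m).mq fl k) → (∃ Δ > 0, (𝒞.scheme m).HasLatticeMassGap Δ) → (∀ᶠ k in Filter.atTop, (𝒞.scheme m).twoPoint k QCDField.glue QCDField.glue (thetaTest 4 𝒞.f₀) 𝒞.f₀ = 1) → (∀ f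 g : Fin Nf, f ≠ g → ∀ᶠ k in Filter.atTop, (𝒞.scheme m).twoPoint k (QCDField.pseudoRe f g) (QCDField.pseudoRe f g) (thetaTest 4 𝒞.f₀) 𝒞.f₀ = 1) → (∃ f g h : SchwartzMap (EuclideanSpace ℝ (Fin 4)) ℝ, tsupport (f : EuclideanSpace ℝ (Fin 4) → ℝ) ⊆ {x | x 0 < 0} ∧ tsupport (g : EuclideanSpace ℝ (Fin 4) → ℝ) ⊆ {x | 0 < x 0 ∧ x 0 < 1} ∧ tsupport (h : EuclideanSpace ℝ (Fin 4) → ℝ) ⊆ {x | 1 < x 0} ∧ ∃ ε > (0 : ℝ), ∀ᶠ k in Filter.atTop, ε ≤ ‖qcdLatticeSchwinger (𝒞.scheme m) k 3 ![QCDField.glue, QCDField.glue, QCDField.glue] ![f, g, h] - qcdLatticeSchwinger (𝒞.scheme m) k 1 ![QCDField.glue] ![f] * qcdLatticeSchwinger (𝒞.scheme m) k 2 ![QCDField.glue, QCDField.glue] ![g, h] - qcdLatticeSchwinger (𝒞.scheme m) k 1 ![QCDField.glue] ![g] * qcdLatticeSchwinger (𝒞.scheme m) k 2 ![QCDField.glue,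 QCDField.glue] ![f, h] - qcdLatticeSchwinger (𝒞.scheme m) k 1 ![QCDField.glue] ![h] * qcdLatticeSchwinger (𝒞.scheme m) k 2 ![QCDField.glue, QCDField.glue] ![f, g] + 2 * (qcdLatticeSchwinger (𝒞.scheme m) k 1 ![QCDField.glue] ![f] * qcdLatticeSchwinger (𝒞.scheme m) k 1 ![QCDField.glue] ![g] * qcdLatticeSchwinger (𝒞.scheme m) k 1 ![QCDField.glue] ![h])‖) → (∀ n : ℕ, n ≠ 0 → ∀ (σ : Fin n → QCDField Nf) (f : Fin n → SchwartzMap (EuclideanSpace ℝ (Fin 4)) ℝ) (F : SchwartzMap (Fin n → EuclideanSpace ℝ (Fin 4)) ℂ), IsTensorOf F (fun i => ofRealTest (f i)) → IsOffDiagonal F → ∃ c : ℂ, Filter.Tendsto (fun k : ℕ => qcdLatticeSchwinger (𝒞.scheme m) k n σ f) Filter.atTop (nhds c)) → ∃ S : LabelledSchwingerFamily (QCDField Nf) (EuclideanSpace ℝ (Fin 4)), S.IsNormalized ∧ S.IsHermitian ∧ S.HasLinearGrowth ∧ (∀ (n : ℕ) (σ : Fin n → QCDField Nf) (a : EuclideanSpace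 ℝ (Fin 4)) (F : SchwartzMap (Fin n → EuclideanSpace ℝ (Fin 4)) ℂ), IsOffDiagonal F → S n σ (translateMulti a F) = S n σ F) ∧ S.IsReflectionPositive ∧ S.IsSymmetric ∧ S.HasClusterProperty ∧ (∀ n : ℕ, n ≠ 0 → ∀ (σ : Fin n → QCDField Nf) (f : Fin n → SchwartzMap (EuclideanSpace ℝ (Fin 4)) ℝ) (F : SchwartzMap (Fin n → EuclideanSpace ℝ (Fin 4)) ℂ), IsTensorOf F (fun i => ofRealTest (f i)) → IsOffDiagonal F → Filter.Tendsto (fun k : ℕ => qcdLatticeSchwinger (𝒞.scheme m) k n σ f) Filter.atTop (nhds (S n σ F))) ∧ (∃ Δ : ℝ, 0 < Δ ∧ S.HasMassGap Δ ∧ (𝒞.scheme m).HasLatticeMassGap Δ) ∧ ((∀ (n : ℕ) (σ : Fin n → QCDField Nf) (Rot : EuclideanSpace ℝ (Fin 4) ≃ₗᵢ[ℝ] EuclideanSpace ℝ (Fin 4)), LinearMap.det (Rot.toLinearEquiv : EuclideanSpace ℝ (Fin 4) →ₗ[ℝ] EuclideanSpace ℝ (Fin 4)) = 1 → ∀ F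 : SchwartzMap (Fin n → EuclideanSpace ℝ (Fin 4)) ℂ, IsOffDiagonal F → S n σ (linActMulti Rot F) = S n σ F) → ∃ T : OSData (QCDField Nf) 4, T.schwinger = S ∧ T.IsNontrivial QCDField.glue ∧ T.IsNonGaussian QCDField.glue ∧ ∀ f g : Fin Nf, f ≠ g → T.IsNontrivial (QCDField.pseudoRe f g))

/-- item stmt-QuantumFields-18920 · support · rank 9 · closed · proved by Summit.QuantumFields.QCD.Theorems.chiralColdCertificateOfSplit_proof @ 72a7c205de85 (prover) · by planner
[support] GLUE of the typed decomposition of the deciding crux ChiralColdCertificate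
(stmt-QuantumFields-17303; BC2 redirect, crux-strategist r1 2026-08-17): ColdHotWitness
(stmt-QuantumFields-18758, ∃, thermodynamic only) → FreeEnergyLimits (stmt-QuantumFields-18759, ∀,
thermodynamic limits exist) → GapImpliesCold (stmt-QuantumFields-18760, ∀, gap ⇒ cold) →
ChiralColdCertificate. PROVED sorry-free (planner Sketch.lean `chiralColdCertificateOfSplit_holds`,
rc 0, axioms propext/Classical.choice/Quot.sound, 27 tactic lines; lands as
Theorems/CounterexampleMustBeHotChiralColdCertificateOfSplit.lean): three of the parent's clauses
are DERIVED, not copied — the physical-branch clause from m_crit(k) > −1 and a_k m_f/Z_m(k) > 0; the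
`Lim` clause by instantiating FreeEnergyLimits at reg.scheme m (β_k ≥ 0, branch at every k);
IsChiralAtZero by contraposition through the quantitative dictionary: given ε > 0, GapImpliesCold at
level θ/2 yields c, the θ-hot tuple m(c·ε) of ColdHotWitness has limits by FreeEnergyLimits, and a
uniform gap ε there would make F_k(⌈1/(a_k cε)⌉) eventually ≤ θ/2 while it is frequently ≥ θ —
absurd (Frequently.and_eventually, linarith). Not a constructor seam. With t -/
@[route_item "route-QuantumFields-CounterexampleMustBeHot"]
def ChiralColdCertificateOfSplit : Prop :=
  ColdHotWitness → FreeEnergyLimits → GapImpliesCold → ChiralColdCertificate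

-- `ChiralColdCertificateOfSplit` holds: proved by `Summit.QuantumFields.QCD.Theorems.chiralColdCertificateOfSplit_proof` @ 72a7c205de85 (its module imports this route file, so no `_holds` link can be stated here).

/-- item stmt-QuantumFields-8840 · support · rank 9 · open · by planner
why it might fail: Stated for ALL N_f (N_f≥17: b₀<0, HasAsymptoticScaling forces β_k→−∞, junk regime), all z_s(k), every sequential limit incl. schemes near Aoki fingers, no Symanzik expansion (SharpeSingleton1998); the k-uniform a²·O₆ insertion bound is an unbuilt UV output (NP precedent: planar-critical only, DKKMO)
sources: CaraccioloEtAl1990, CaraccioloEtAl1988, Symanzik1983, LangRebbi1982, DavoudiSavage2012, DKKMO2020Rotational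
[crux] E1 MODULE FOR QCD. For every N_f, every sequential lattice-QCD scheme sch with two-loop
asymptotic scaling, bare Wilson masses eventually on the physical branch m_f(k) > −1, and a uniform
lattice mass gap, every labelled Schwinger family S on (ℝ⁴)ⁿ that is the k → ∞ limit of the honest
lattice QCD n-point functions `qcdLatticeSchwinger sch k` on off-diagonal tensor test functions is
invariant under proper rotations on ⁰𝒮 (the rotation half of `IsEuclideanInvariant`). Intended
engine (card K2): conserved lattice angular-momentum current from the CCMP lattice energy–momentum
tensor, whose hypercubic-to-O(4) defect is a_k² × (dimension-6 gluonic and fermionic operators),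
plus k-uniform insertion bounds from the UV construction; alternative engines: Σ5 commensurate
self-comparison (card coincidence-lattice-rotation-bootstrap), never diagonal mirrors. [difficulty:
open-problem] -/
@[route_item "route-QuantumFields-CounterexampleMustBeHot", crux]
def RotationRestoration : Prop :=
  ∀ (Nf : ℕ) (sch : Literature.MathematicalPhysics.QuantumFieldTheory.QCDScheme Nf), sch.HasAsymptoticScaling → (∀ fl : Fin Nf, ∀ᶠ k in Filter.atTop, -1 < sch.mq fl k) → (∃ Δ : ℝ, 0 < Δ ∧ sch.HasLatticeMassGap Δ) → ∀ S : Literature.MathematicalPhysics.AQFT.LabelledSchwingerFamily (Literature.MathematicalPhysics.QuantumFieldTheory.QCDField Nf) (EuclideanSpace ℝ (Fin 4)), (∀ n : ℕ, n ≠ 0 → ∀ (σ : Fin n → Literature.MathematicalPhysics.QuantumFieldTheory.QCDField Nf) (f : Fin n → SchwartzMap (EuclideanSpace ℝ (Fin 4)) ℝ) (F : SchwartzMap (Fin n → EuclideanSpace ℝ (Fin 4)) ℂ), Literature.MathematicalPhysics.QuantumLattice.IsTensorOf F (fun i => Literature.MathematicalPhysics.QuantumLattice.ofRealTest (f i)) →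 Literature.MathematicalPhysics.AQFT.IsOffDiagonal F → Filter.Tendsto (fun k : ℕ => Literature.MathematicalPhysics.QuantumFieldTheory.qcdLatticeSchwinger sch k n σ f) Filter.atTop (nhds (S n σ F))) → ∀ (n : ℕ) (σ : Fin n → Literature.MathematicalPhysics.QuantumFieldTheory.QCDField Nf) (Rot : EuclideanSpace ℝ (Fin 4) ≃ₗᵢ[ℝ] EuclideanSpace ℝ (Fin 4)), LinearMap.det (Rot.toLinearEquiv : EuclideanSpace ℝ (Fin 4) →ₗ[ℝ] EuclideanSpace ℝ (Fin 4)) = 1 → ∀ F : SchwartzMap (Fin n → EuclideanSpace ℝ (Fin 4)) ℂ, Literature.MathematicalPhysics.AQFT.IsOffDiagonal F → S n σ (Literature.MathematicalPhysics.QuantumLattice.linActMulti Rot F) = S n σ F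

-- earlier Assembly (stmt-QuantumFields-10195, replaced 2026-08-16T23:18:14Z -> stmt-QuantumFields-17389): retired by None — ThetaPlusTransport → ColdCertificate → ColdInfraredGap → OffsetToFull → ContinuumComplement → QCD
-- earlier Assembly (stmt-QuantumFields-17389, replaced 2026-08-17T03:12:53Z -> stmt-QuantumFields-19000): retired by None — ThetaPlusTransport → ChiralColdCertificate → ColdInfraredGap → ChiralContinuumComplement → QCD
/-- item stmt-QuantumFields-19000 · assembly · rank 1 · closed · proved by Summit.QuantumFields.QCD.Theorems.counterexampleMustBeHot_assembly_proof (prover) · by planner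
sources: JaffeWitten2000, doi:10.1103/physrevd.60.045003
[assembly] ThetaPlusTransport → ColdHotWitness → FreeEnergyLimits → GapImpliesCold → ColdInfraredGap
→ ChiralContinuumComplement → QCD (the conjunct `QCD` of Summits/QuantumFields/QCD/Statement.lean):
literally the type of the deciding theorem `closes` after the re-leaving of 2026-08-17
(crux-strategist r1, RESTATED re-audit of the former deciding crux ChiralColdCertificate, now the
derived support node of its decomposition ColdHotWitness/FreeEnergyLimits/GapImpliesCold with proved
glue ChiralColdCertificateOfSplit). Pure logic: derive ChiralColdCertificate from the three pieces
(27 lines: branch clause by positivity of a_k m_f/Z_m(k) over m_crit(k) > −1; `Lim` from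
FreeEnergyLimits; IsChiralAtZero by the hot/cold clash at T = c·ε through GapImpliesCold), then the
rev-4 chain (ThetaPlusTransport turns the certificate into coldness below T₁, ColdInfraredGap into a
uniform lattice gap, ChiralContinuumComplement into QCD). [difficulty: provable-now — it is
`closes`] Sources: JaffeWitten2000, doi:10.1103/physrevd.60.045003. -/
@[route_item "route-QuantumFields-CounterexampleMustBeHot"]
def Assembly : Prop :=
  ThetaPlusTransport → ColdHotWitness → FreeEnergyLimits → GapImpliesCold → ColdInfraredGap → ChiralContinuumComplement → QCD

-- `Assembly` holds: proved by `Summit.QuantumFields.QCD.Theorems.counterexampleMustBeHot_assembly_proof` (its module imports this route file, so no `_holds` link can be stated here).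

-- records of items no longer active in this route (dropped / restated):
-- earlier OffsetToFull (stmt-QuantumFields-9529, dropped 2026-08-16T23:20:24Z): proved by Summit.QuantumFields.QCD.Theorems.offsetToFull_proof — (∀ Nf : ℕ, Nf = 2 ∨ Nf = 3 → ∃ reg : Literature.MathematicalPhysics.QuantumFieldTheory.QCDRegularisation Nf, reg.HasMassScaling ∧ (reg.scheme 0 0 0).HasAsymptoticScaling ∧ ∃ M₀ : ℝ, 0 ≤ M₀ ∧ ∀ m : Fin Nf → ℝ, (∀ f, M₀ < m f) → (∀ f, ∀ᶠ k in Filter.atTop, -1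

/-! D-0027 §2.1 — DECIDING THEOREM (planner-authored via `route open/edit --closes-file`; by planner-cstrat-stmt-QuantumFields-17303-r1-0 2026-08-17T03:11:25Z):
its hypotheses are this route's items and its conclusion the sub-problem Statement (glue_lint), and it elaborates with this file. -/

/-- D-0027 §2.1 deciding theorem of route CounterexampleMustBeHot, RE-GLUED on the decomposition of the
former deciding crux `ChiralColdCertificate` (crux-strategist r1, 2026-08-17): the three pieces
`ColdHotWitness` (∃, thermodynamic), `FreeEnergyLimits` (∀, limits exist), `GapImpliesCold` (∀, gap ⇒ cold)
replace `ChiralColdCertificate` as hypotheses; `ChiralColdCertificate` is DERIVED inside (support glue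
`ChiralColdCertificateOfSplit`, same 27 lines) and then the rev-4 chain `ThetaPlusTransport → · → ColdInfraredGap →
ChiralContinuumComplement → QCD` runs unchanged. Pure logic; axioms propext / Classical.choice / Quot.sound. -/
@[closes "route-QuantumFields-CounterexampleMustBeHot"] theorem closes (h₁ : ThetaPlusTransport) (hW : ColdHotWitness) (hL : FreeEnergyLimits) (hG : GapImpliesCold)
    (h₃ : ColdInfraredGap) (h₄ : ChiralContinuumComplement) : QCD := by
  -- the former deciding crux, derived from its three pieces
  have h₂ : ChiralColdCertificate := by
    intro Nf hNf
    obtain ⟨reg, hms, has, hβ, hcrit, hcold, θ, hθ, hhot⟩ := hW Nf hNf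
    have hbranch : ∀ m : Fin Nf → ℝ, (∀ fl, 0 < m fl) →
        ∀ (fl : Fin Nf) (k : ℕ), -1 < (reg.scheme m 0 0).mq fl k := by
      intro m hm fl k
      rw [Literature.MathematicalPhysics.QuantumFieldTheory.QCDRegularisation.scheme_mq]
      have hpos : 0 < reg.a k * m fl / reg.Zm k :=
        div_pos (mul_pos (reg.a_pos k) (hm fl)) (reg.Zm_pos k)
      linarith [hcrit k]
    refine ⟨reg, hms, ?_, has, fun m hm => ?_⟩
    · intro ε hε
      obtain ⟨c, hc, hgapcold⟩ := hG Nf hNf reg hms has (θ / 2) (half_pos hθ)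
      obtain ⟨m, hm, hhotm⟩ := hhot (c * ε) (mul_pos hc hε)
      refine ⟨m, hm, fun hgap => ?_⟩
      obtain ⟨φ, e₀, hφ⟩ := hL Nf hNf (reg.scheme m 0 0) hβ (hbranch m hm)
      have hfreq := hhotm φ e₀ hφ
      have hev := hgapcold m hm (fun fl => Filter.Eventually.of_forall (hbranch m hm fl)) ε hε hgap φ e₀ hφ
        (c * ε) (mul_pos hc hε) le_rfl
      obtain ⟨k, hk₁, hk₂⟩ := (hfreq.and_eventually hev).exists
      linarith
    · obtain ⟨φ, e₀, hφ⟩ := hL Nf hNf (reg.scheme m 0 0) hβ (hbranch m hm)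
      obtain ⟨η, hη, T₁, hT₁, hc⟩ := hcold m hm
      exact ⟨fun fl => Filter.Eventually.of_forall (hbranch m hm fl), φ, e₀, hφ, η, hη, T₁, hT₁, hc φ e₀ hφ⟩
  -- the rev-4 chain
  refine h₄ fun Nf hNf => ?_
  obtain ⟨reg, hms, hchi, has, H⟩ := h₂ Nf hNf
  refine ⟨reg, hms, hchi, has, fun m hm => ?_⟩
  obtain ⟨hbr, φ, e₀, hlim, η, hη, T₁, hT₁, hfin⟩ := H m hm
  exact ⟨hbr, h₃ Nf hNf reg hms has m hbr φ e₀ hlim η hη T₁ hT₁ hfin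
    (h₁ Nf hNf reg hms has m hbr φ e₀ hlim η hη T₁ hT₁ hfin)⟩

end Summit.QuantumFields.QCD.Theses.CounterexampleMustBeHot
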